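import Literature.Analysis.FluidPDE.SteadyLiouvilleTsaiEnergy
import Literature.Analysis.FunctionSpaces.WeakLpQuantitative
import Mathlib.Analysis.Calculus.ParametricIntegral
import HarnessLib

/-!
# CLAIM C178 `Nahiru2026` — «A LIOUVILLE THEOREM FOR STATIONARY NAVIER–STOKES IN L^{3,∞}(R³), AND THE
ENDPOINT GAP IN THE CLAY REGULARITY CHAIN» (printed «AIRO NAHIRU», «Date: April 23, 2026»; text of
record = Zenodo record 19720004, resource type «Software», ONE version 2026-04-24, file
`finish_navier_stokes-v0.1.zip` sha16 d8fc0d7baa0c4adf ⊃ `paper/paper.pdf` sha16 91cf176daea92805,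
22 pp., PDF page = printed page; cell ns-claims, D-0090, RULINGS v1.51 (2): a LADDER row, rung 3
(critical steady Liouville) — NOT a Clay claim as printed)

[claim: Nahiru2026, status: disputed] — NOTHING in this file is asserted as a theorem of the tree except
the declarations explicitly marked PROVED (pure logic / tree facts). Every `def Step_… : Prop` is the
AUTHOR'S assertion, typed as printed, with its locator. The zip's own Lean 4 skeleton (placeholder axioms,
`sorry` bodies, «three open sorrys» §14) is RECORDED here and neither imported nor trusted.

WHAT THIS IS NOT: not a claim about NS regularity or blow-up; not a claim about any author beyond the
typed locator.

## Claimed statement (Theorem 1.1 (Stationary L^{3,∞} Liouville) p.2 l.47–55)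
«Let v : R³ → R³ be smooth, divergence-free, and satisfy the stationary Navier–Stokes equations
−ν∆v + (v·∇)v + ∇p = 0, ∇·v = 0 on R³, with ∥v∥_{L^{3,∞}(R³)} < ∞. Then v ≡ 0.» — no smallness, no decay
at infinity, no finite-Dirichlet-energy hypothesis (FDE is DERIVED, Thm 9.1). Typed over the tree's steady
vocabulary: `IsLerayProfile ν 0 v p` (= `−νΔv + (v·∇)v + ∇p = 0`, `div v = 0`, `v ∈ C²`, `p ∈ C¹`; the
predicate `Wu2026_thm11` / `Tsai2021_annular_liouville` are stated with) + `C^∞` + the weak-`L³`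
membership `FunctionSpaces.MemWeakLp v 3 volume` (tree `WeakLp.lean`; `M := ‖v‖_{L^{3,∞}}` =
`(eWeakLpPow v 3 volume)^{1/3}`, §2 p.4 l.18–23). Corollaries 1.2 (ℝ⁴), 1.3 (W^{1,2}_loc), 1.4
(quantitative) p.3 are RECORDED, not typed.

## LITERATURE / TREE STATUS OF THE CLAIM (typist's record, STATUS 2026-08-27T18:49:38Z; no verdict on
the printed chain): the claimed statement is implied by Seregin–Wang 2020 Thm 1.1 (ii) (12/5 < q < 3,
ℓ = ∞, γ = 1 > 1/3 + 1/q, `liminf M_{γ,q,ℓ}(R) < ∞` via the Lorentz nesting on annuli) and by Tsai 2021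
Thm 1.1 (a) with δ = 1 — the latter is the TREE THEOREM `Tsai2021_annular_liouville_holds`
(`SteadyLiouvilleTsaiEnergy.lean`), whose hypothesis `liminf_R R⁻¹‖v‖²_{L^{12/5}(R<|x|<2R)} = 0` follows
from `v ∈ L^{3,∞}` by the print's own Cor 6.2 (r = 12/5). An in-file `claimedTheorem_holds` through that
door is the announced TRUE-column rev 2. The print's priority sentence p.3 l.3 («Theorem 1.1 completes the
KNSS program for the general three-dimensional case») is contradicted by these 2020/2021 results (record).
[cite: SereginWang2020, Thm 1.1 (ii)] [cite: Tsai2021, Thm 1.1 (a)]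

## Setting / grain notes
* `ν > 0` fixed (§2 p.4 l.18). `M > 0` may be assumed (§2 p.4 l.22–23: `M = 0` ⇒ `v = 0`).
* §2 STANDING CONVENTION: «v denotes a smooth divergence-free stationary solution … with M := ‖v‖ < ∞»;
  every constant `C(θ, ν, M)` of §§5–8 is therefore typed AFTER the solution (`∀ v p, … → ∃ C, ∀ ρ`),
  exactly the dependence the print states (through `M = M(v)`), never uniform beyond it.
* `|∇v|²` = `frobeniusNormSq (fderiv ℝ v x)` (tree); `A(θρ, ρ) = B_ρ ∖ B_{θρ}` with OPEN balls as printed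
  (Notation 2.1 p.4 l.24–27); the hat `φ` (p.4 l.28–37) and `E(ρ)`, `D(ρ)` (p.4 l.38–46) have bodies below.
* Real (Bochner) integrals throughout: for smooth `v` every integrand below is continuous on a compact
  set (the hat vanishes for `|x| ≥ ρ`), so no junk values arise on the typed class.
* TYPIST'S FLAG (records, not a verdict): §5 takes `η` = the Lipschitz hat `φ(|·|/ρ)` (p.8 l.78–88) so that
  `∫|∇v|²η = E(ρ)`, while Term I1 (p.8 l.127–136) uses «|∆η| ≤ C_θ/ρ² on A(θρ, ρ) (supp of ∆η)» from the
  SMOOTH cutoff family (7) p.7 l.3–19; the hat's distributional Laplacian carries sphere layers at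
  `|x| = θρ, ρ`. The Steps below type Prop 5.1 at the grain Thm 7.3 CONSUMES it ((11) with the two printed
  bounds substituted), where the slip is invisible; the literal I1 display is typed separately for the
  smooth family (7) (`Step_P51_I1`).

## ORDERED STEP INDEX (dependency order of the printed proof, §§2–10; «Sections 3–10 prove Theorem 1.1
in eight steps», p.4 l.13)
 1. `Step_L22`   — Lemma 2.2 (2)–(3) p.4 l.52 – p.5 l.9: `E` non-decreasing, differentiable,
                   `D(ρ) ≤ ((1−θ)/θ) ρ E′(ρ)`. TRUE-type (calculus).
 2. `Step_P51`   — Prop 5.1 (11) p.8 l.89–106 WITH the printed bounds on I1 (p.9 l.3–8) and on the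
                   convective cutoff (p.9 l.67–77) substituted = the form Thm 7.3's proof uses (p.12 l.26–53):
                   `νE(ρ) ≤ C⋆ρ^{−1/2}D^{1/2} + C_θνM²/(2ρ)·(…) + (C_θ/2ρ)‖v‖³_{L³(A)}`. TRUE-type in
                   substance (Bogovskiĭ test function §4 + Cauchy–Schwarz + Lorentz); see the FLAG above.
 2'. `Step_P51_I1` — Term I1's display for the SMOOTH cutoffs (7): `|∫|v|²∆η| ≤ C_θρ^{−2}‖v‖²_{L²(A)}`.
 3. `Step_C62`   — Cor 6.2 (13) p.10 l.97–103 (from Prop 6.1 (12), pure layer-cake): for every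
                   `f ∈ L^{3,∞}` and `r ∈ (0,3)`, `‖f‖_{L^r(A(θρ,ρ))} ≤ C_{r,θ} M ρ^{3/r−1}`. TRUE
                   (tree: `MemWeakLp.setLIntegral_rpow_le`).
 4. `Step_P72`   — Prop 7.2 (16)–(17) p.11 l.74–98: GN on annuli with exact ρ-cancellation,
                   `‖v‖³_{L³(A)} ≤ C'(CM)^a ρ^b D^b + C'(CM)³`, `a = 3p/(6−p)`, `b = 3(3−p)/(6−p)`. TRUE-type.
 5. `Step_T73`   — Thm 7.3 (18) p.12 l.20–25, THE KEY ESTIMATE: `E(ρ) ≤ K₀ρ^{−1/2}D^{1/2} + K₁ρ^{−1}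
                   + K₂ρ^γD^b`, `γ = (3−2p)/(6−p)`, every ρ > 0. (Derived in print from 2–4.)
 6. `Step_P81`   — Prop 8.1 (19) p.12 l.118 – p.13 l.14: if `E → ∞` then `E′ ≥ cρ^{−α}E^β` for ρ ≥ ρ*,
                   `α = (12−5p)/(3(3−p)) < 1 < β = (6−p)/(3(3−p))`, `p ∈ (3/2, 12/5]`. (From 1 + 5.)
 7. `Step_T91`   — Thm 9.1 p.14 l.5–8: `∫_{ℝ³}|∇v|² < ∞`. (From 1 + 6 by the ODE comparison p.14.)
 8. `Step_L101`  — Lemma 10.1 p.14 l.115 – p.15 l.37: `v ∈ L⁶`, `‖v‖₆ ≤ C‖∇v‖₂`; `p ∈ L³` modulo a constant.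
 9. `Step_S10`   — §10 «Proof of Theorem 1.1» p.15 l.38 – p.16: FDE ⇒ `v ≡ 0` by testing with `vφ_R²`
                   ((21), J1–J3 → 0). TRUE-type (for `L^{3,∞} ∩ Ẇ^{1,2}` this is classical: Galdi via
                   `L^{3,∞} ∩ L⁶ ⊂ L^{9/2}`, or the tree's Tsai door).
10. `claim_of_steps` — PROVED: binders in print order; the kernel consumes `Step_T91` and `Step_S10`
    (the last two links); 1–6 and 8 are the printed inputs of 7 and 9 and are carried for the index.
-/

noncomputable section

open MeasureTheory Set Filter Metric Topology
open scoped ENNReal NNReal Laplacian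

namespace Literature.Claims.NS.Nahiru2026

open Literature.Analysis.FluidPDE Literature.Analysis.FunctionSpaces

/-! ## §A Vocabulary (definitions with bodies; nothing asserted) -/

/-- Physical space `ℝ³`. [cite: Nahiru2026, Thm 1.1 p.2 l.47–55 (statement l.48–55)] -/
abbrev E3 : Type := EuclideanSpace ℝ (Fin 3)

/-- `M := ‖v‖_{L^{3,∞}(ℝ³)}` (§2 p.4 l.21), as `(sup_t t³ |{|v| > t}|)^{1/3}` in `ℝ≥0∞` turned real (the
Steps carry `MemWeakLp v 3 volume`, under which the supremum is finite). [cite: Nahiru2026, §2 p.4 l.18–23] -/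
def M (v : E3 → E3) : ℝ := ((eWeakLpPow v 3 volume) ^ (1 / 3 : ℝ)).toReal

/-- «smooth, divergence-free, stationary Navier–Stokes on ℝ³ with viscosity ν» (Thm 1.1; §2 p.4
l.18–20): the tree's steady profile system at `a = 0` (`−νΔv + (v·∇)v + ∇p = 0`, `div v = 0`) with `v`,
`p` smooth. [cite: Nahiru2026, Thm 1.1 p.2 l.47–55; (1) p.2 l.29] -/
def IsSolution (ν : ℝ) (v : E3 → E3) (p : E3 → ℝ) : Prop :=
  IsLerayProfile ν 0 v p ∧ ContDiff ℝ (⊤ : ℕ∞) v ∧ ContDiff ℝ (⊤ : ℕ∞) p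

/-- The hat function `φ : [0,∞) → [0,1]`: `1` on `[0,θ)`, `(1−t)/(1−θ)` on `[θ,1)`, `0` on `[1,∞)`
(Notation 2.1 p.4 l.28–37). [cite: Nahiru2026, Notation 2.1 p.4 l.28–37] -/
def hat (θ t : ℝ) : ℝ := if t < θ then 1 else if t < 1 then (1 - t) / (1 - θ) else 0

/-- The annulus `A(θρ, ρ) := B_ρ ∖ B_{θρ}` (open balls centred at the origin, as printed).
[cite: Nahiru2026, Notation 2.1 p.4 l.24–27] -/
def annulus (θ ρ : ℝ) : Set E3 := ball (0 : E3) ρ \ ball (0 : E3) (θ * ρ)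

/-- `|∇v(x)|²` (Frobenius). [cite: Nahiru2026, §2 p.4 l.38–46] -/
def gradSq (v : E3 → E3) (x : E3) : ℝ := frobeniusNormSq (fderiv ℝ v x)

/-- The weighted energy `E(ρ) := ∫_{ℝ³} |∇v(x)|² φ(|x|/ρ) dx` (p.4 l.38–42).
[cite: Nahiru2026, Notation 2.1 p.4 l.38–42] -/
def E (θ : ℝ) (v : E3 → E3) (ρ : ℝ) : ℝ := ∫ x, gradSq v x * hat θ (‖x‖ / ρ)

/-- The annular gradient norm `D(ρ) := ‖∇v‖²_{L²(A(θρ,ρ))}` (p.4 l.43–46). [cite: Nahiru2026, Notation 2.1 p.4 l.43–46] -/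
def D (θ : ℝ) (v : E3 → E3) (ρ : ℝ) : ℝ := ∫ x in annulus θ ρ, gradSq v x

/-- `‖f‖_{L^r(A(θρ,ρ))}` for a real exponent `r > 0` (real-valued; §6–§7).
[cite: Nahiru2026, Prop 6.1 (12) p.10; Cor 6.2 (13) p.10] -/
def lrA (r θ : ℝ) (f : E3 → E3) (ρ : ℝ) : ℝ := (∫ x in annulus θ ρ, ‖f x‖ ^ r) ^ (1 / r)

/-- A radial cutoff of the SMOOTH family (7) p.7 l.3–19 at scale ρ: `η ∈ C^∞_c`, `η ≡ 1` on `B_{θρ}`,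
`supp η ⊂ B_ρ`, `0 ≤ η ≤ 1`, `|∇η| ≤ C_θ/ρ`, `|Δη| ≤ C_θ/ρ²`, `supp ∇η ⊂ A(θρ,ρ)`.
[cite: Nahiru2026, (7) p.7 l.3–19] -/
def IsCutoff (θ ρ Cθ : ℝ) (η : E3 → ℝ) : Prop :=
  ContDiff ℝ (⊤ : ℕ∞) η ∧ (∀ x, ‖x‖ < θ * ρ → η x = 1) ∧ (∀ x, ρ ≤ ‖x‖ → η x = 0) ∧
    (∀ x, 0 ≤ η x ∧ η x ≤ 1) ∧ (∀ x, ‖fderiv ℝ η x‖ ≤ Cθ / ρ) ∧ (∀ x, |(Δ η) x| ≤ Cθ / ρ ^ 2)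

/-! ## §B The claimed statement -/

/-- **CLAIMED THEOREM = Theorem 1.1 (Stationary L^{3,∞} Liouville) p.2 l.47–55**: every smooth
divergence-free stationary solution on `ℝ³` (any `ν > 0`) with `‖v‖_{L^{3,∞}} < ∞` is identically zero.
[claim: Nahiru2026, status: disputed] [cite: Nahiru2026, Thm 1.1 p.2 l.47–55] -/
def ClaimedTheorem : Prop :=
  ∀ ν : ℝ, 0 < ν → ∀ (v : E3 → E3) (p : E3 → ℝ), IsSolution ν v p →
    MemWeakLp v 3 volume → v = 0

/-! ## §C The Steps of the printed proof (§§2–10), typed as printed; none asserted -/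

/-- **Step 1 — Lemma 2.2 (Hat-function derivative formula) (2)–(3) p.4 l.52 – p.5 l.9**: «E′(ρ) =
(1/((1−θ)ρ²)) ∫_{A(θρ,ρ)} |∇v|²|x| dx ≥ (θ/((1−θ)ρ)) D(ρ). In particular, E is absolutely continuous and
non-decreasing in ρ, and D(ρ) ≤ ((1−θ)/θ) ρ E′(ρ).» Typed: `E` is monotone on `(0,∞)` and has at every
`ρ > 0` a derivative `E′(ρ)` given by (2) and obeying (3). The proof uses only «v smooth and φ weakly
differentiable» (p.5 l.10–11), so the Step is typed for every smooth field (the standing solution `v` of §2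
is one). TRUE-type (calculus; typist's flag).
[claim: Nahiru2026, status: disputed] [cite: Nahiru2026, Lemma 2.2 (2)–(3) p.4 l.52 – p.5 l.42] -/
def Step_L22 : Prop :=
  ∀ θ : ℝ, 0 < θ → θ < 1 → ∀ v : E3 → E3, ContDiff ℝ (⊤ : ℕ∞) v →
    MonotoneOn (E θ v) (Ioi 0) ∧
      ∃ E' : ℝ → ℝ, ∀ ρ : ℝ, 0 < ρ →
        HasDerivAt (E θ v) (E' ρ) ρ ∧
          E' ρ = (1 / ((1 - θ) * ρ ^ 2)) * ∫ x in annulus θ ρ, gradSq v x * ‖x‖ ∧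
            D θ v ρ ≤ (1 - θ) / θ * ρ * E' ρ

/-- **Step 2 — Proposition 5.1 (Sublinear Caccioppoli estimate) (11) p.8 l.89–106, at the grain the key
estimate consumes it (Thm 7.3 proof p.12 l.26–53)**: «There is a constant C⋆ = C⋆(θ, ν, M) such that for
every ρ > 0, νE(ρ) ≤ C⋆ρ^{−1/2}D(ρ)^{1/2} + (ν/2)|I1(ρ)| + ½∫|v|²|v·∇η| dx, where |I1(ρ)| ≤ C_θνM²/ρ, and
the third term is bounded by C_θρ^{−1}‖v‖³_{L³(A(θρ,ρ))}» — typed with the two printed bounds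
substituted (constants after the solution, §2 standing convention). Printed derivation: identity (9)
(Prop 4.6, test function `w = vη − B[v·∇η]`, Lemma 4.1/Cor 4.4/Lemma 4.5) + Terms I1, I2, I4 (p.8 l.127 –
p.9 l.66) + Lorentz (§6). See the module FLAG on Term I1 for the hat. [claim: Nahiru2026, status: disputed]
[cite: Nahiru2026, Prop 5.1 (11) p.8 l.89–106; p.9 l.3–77; Prop 4.6 (9) p.7 l.65–91] -/
def Step_P51 : Prop :=
  ∀ ν : ℝ, 0 < ν → ∀ θ : ℝ, 0 < θ → θ < 1 → ∀ (v : E3 → E3) (p : E3 → ℝ), IsSolution ν v p →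
    MemWeakLp v 3 volume →
      ∃ Cstar C1 C3 : ℝ, 0 ≤ Cstar ∧ 0 ≤ C1 ∧ 0 ≤ C3 ∧ ∀ ρ : ℝ, 0 < ρ →
        ν * E θ v ρ ≤ Cstar * ρ ^ (-(1 / 2 : ℝ)) * (D θ v ρ) ^ (1 / 2 : ℝ) + C1 * ρ⁻¹ +
          C3 * ρ⁻¹ * (lrA 3 θ v ρ) ^ 3

/-- **Step 2′ — Term I1's display for the SMOOTH cutoff family (7)** (p.8 l.127–136: «Using |∆η| ≤ C_θ/ρ²
on A(θρ, ρ) (supp of ∆η), |I1| := |∫|v|²∆η dx| ≤ (C_θ/ρ²)‖v‖²_{L²(A(θρ,ρ))}»): for every field and every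
cutoff of the family (7). TRUE for (7) (typist's flag); NOT typable for the Lipschitz hat of §5 (no bounded
Laplacian) — records. [claim: Nahiru2026, status: disputed] [cite: Nahiru2026, Term I1 p.8 l.127–136; (7) p.7 l.3–19] -/
def Step_P51_I1 : Prop :=
  ∀ θ : ℝ, 0 < θ → θ < 1 → ∀ Cθ : ℝ, ∀ ρ : ℝ, 0 < ρ → ∀ (η : E3 → ℝ), IsCutoff θ ρ Cθ η →
    ∀ v : E3 → E3, ContDiff ℝ (⊤ : ℕ∞) v →
      |∫ x, ‖v x‖ ^ 2 * (Δ η) x| ≤ Cθ / ρ ^ 2 * ∫ x in annulus θ ρ, ‖v x‖ ^ 2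

/-- **Step 3 — Corollary 6.2 (Lorentz bound on the annulus) (13) p.10 l.97–103** (from Prop 6.1 (12)
p.10 l.9–21, Cavalieri + the two-piece bound on the distribution function): «For every r ∈ (0, 3) and
every ρ > 0, ‖v‖_{L^r(A(θρ,ρ))} ≤ C_{r,θ} M ρ^{3/r−1}» — typed as Prop 6.1 prints it, for EVERY
`f ∈ L^{3,∞}(ℝ³)` (then «apply with f = v», p.10 l.88). TRUE (tree: `MemWeakLp.setLIntegral_rpow_le`;
typist's flag). [claim: Nahiru2026, status: disputed] [cite: Nahiru2026, Cor 6.2 (13) p.10 l.97–103; Prop 6.1 (12) p.10 l.9–87] -/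
def Step_C62 : Prop :=
  ∀ θ : ℝ, 0 < θ → θ < 1 → ∀ r : ℝ, 0 < r → r < 3 → ∃ C : ℝ, 0 ≤ C ∧
    ∀ f : E3 → E3, MemWeakLp f 3 volume → ∀ ρ : ℝ, 0 < ρ →
      lrA r θ f ρ ≤ C * M f * ρ ^ (3 / r - 1)

/-- **Step 4 — Proposition 7.2 (Critical GN bound with exact ρ-cancellation) (16)–(17) p.11 l.74–98**
(Lemma 7.1 (14)–(15) GN on the reference annulus, rescaling `ṽ(y) = v(ρy)`, `3 − 3a/p − b = 0`):
«‖v‖³_{L³(A(θρ,ρ))} ≤ C'_GN (CM)^a ρ^b D(ρ)^b + C'_GN (CM)³», `a = 3p/(6−p)`, `b = 3(3−p)/(6−p)`,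
`p ∈ (3/2, 3)`, every ρ > 0. The printed proof uses only Lemma 7.1 (GN on the reference annulus,
«for every w ∈ W^{1,2} ∩ L^p(A(θ,1))») rescaled, and the Lorentz bound (13) — no equation — so the Step is
typed for every smooth field in `L^{3,∞}` (the standing solution `v` of §2 is one), constants after the
field (through `M`). TRUE-type (GN on John annuli; typist's flag).
[claim: Nahiru2026, status: disputed] [cite: Nahiru2026, Prop 7.2 (16)–(17) p.11 l.74 – p.12 l.18; Lemma 7.1 p.11 l.17–72] -/
def Step_P72 : Prop :=
  ∀ θ : ℝ, 0 < θ → θ < 1 → ∀ q : ℝ, 3 / 2 < q → q < 3 →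
    ∀ v : E3 → E3, ContDiff ℝ (⊤ : ℕ∞) v → MemWeakLp v 3 volume →
      ∃ C : ℝ, 0 ≤ C ∧ ∀ ρ : ℝ, 0 < ρ →
        (lrA 3 θ v ρ) ^ 3 ≤
          C * M v ^ (3 * q / (6 - q)) * ρ ^ (3 * (3 - q) / (6 - q)) * (D θ v ρ) ^ (3 * (3 - q) / (6 - q)) +
            C * M v ^ 3

/-- **Step 5 — Theorem 7.3 (Main sublinear estimate on E) (18) p.12 l.20–25, THE KEY ESTIMATE**: «Fix
θ ∈ (0,1) and p ∈ (3/2,3), with γ := (3−2p)/(6−p) and b := 3(3−p)/(6−p). There are constants K₀, K₁,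
K₂ depending only on (θ, ν, M, p) such that, for every ρ > 0, E(ρ) ≤ K₀ρ^{−1/2}D(ρ)^{1/2} + K₁ρ^{−1} +
K₂ρ^γD(ρ)^b.» Printed proof p.12 l.26–97: (11)/ν + |I1| ≤ C_θM²/ρ + (17) with `b − 1 = γ`.
[claim: Nahiru2026, status: disputed] [cite: Nahiru2026, Thm 7.3 (18) p.12 l.20–97] -/
def Step_T73 : Prop :=
  ∀ ν : ℝ, 0 < ν → ∀ θ : ℝ, 0 < θ → θ < 1 → ∀ q : ℝ, 3 / 2 < q → q < 3 →
    ∀ (v : E3 → E3) (p : E3 → ℝ), IsSolution ν v p → MemWeakLp v 3 volume →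
      ∃ K0 K1 K2 : ℝ, 0 ≤ K0 ∧ 0 ≤ K1 ∧ 0 ≤ K2 ∧ ∀ ρ : ℝ, 0 < ρ →
        E θ v ρ ≤ K0 * ρ ^ (-(1 / 2 : ℝ)) * (D θ v ρ) ^ (1 / 2 : ℝ) + K1 * ρ⁻¹ +
          K2 * ρ ^ ((3 - 2 * q) / (6 - q)) * (D θ v ρ) ^ (3 * (3 - q) / (6 - q))

/-- **Step 6 — Proposition 8.1 (Superlinear ODE) (19) p.12 l.118 – p.13 l.14** (proof p.13 l.15–102:
`D^{1/2} ≤ D^b + 1` for `b ≥ 1/2`, (20), `½E ≤ Kρ^γD^b` for ρ ≥ ρ₁, Lemma 2.2): «Fix p ∈ (3/2, 12/5]. If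
lim_{ρ→∞} E(ρ) = +∞, then there exist c > 0 and ρ* ≥ 1, depending on (θ, ν, M, p), such that
E′(ρ) ≥ cρ^{−α}E(ρ)^β for all ρ ≥ ρ*, with α = (12−5p)/(3(3−p)), β = (6−p)/(3(3−p)). Moreover α < 1 and
β > 1.» Typed with the derivative as `deriv (E θ v) ρ`. [claim: Nahiru2026, status: disputed]
[cite: Nahiru2026, Prop 8.1 (19) p.12 l.118 – p.13 l.102] -/
def Step_P81 : Prop :=
  ∀ ν : ℝ, 0 < ν → ∀ θ : ℝ, 0 < θ → θ < 1 → ∀ q : ℝ, 3 / 2 < q → q ≤ 12 / 5 →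
    ∀ (v : E3 → E3) (p : E3 → ℝ), IsSolution ν v p → MemWeakLp v 3 volume →
      Tendsto (E θ v) atTop atTop →
        ∃ c ρstar : ℝ, 0 < c ∧ 1 ≤ ρstar ∧ ∀ ρ : ℝ, ρstar ≤ ρ →
          c * ρ ^ (-((12 - 5 * q) / (3 * (3 - q)))) * (E θ v ρ) ^ ((6 - q) / (3 * (3 - q))) ≤
            deriv (E θ v) ρ

/-- The exponent facts «α < 1 and β > 1 for every p ∈ (3/2, 3)» (Prop 8.1, p.13 l.14 and l.76–102) —
PROVED (arithmetic). [cite: Nahiru2026, Prop 8.1 p.13 l.76–102] -/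
theorem alpha_lt_one_and_one_lt_beta {q : ℝ} (h1 : 3 / 2 < q) (h2 : q < 3) :
    (12 - 5 * q) / (3 * (3 - q)) < 1 ∧ 1 < (6 - q) / (3 * (3 - q)) := by
  have h3 : 0 < 3 * (3 - q) := by linarith
  constructor
  · rw [div_lt_one h3]; linarith
  · rw [one_lt_div h3]; linarith

/-- **Step 7 — Theorem 9.1 (Finite Dirichlet energy) p.14 l.5–8**: «∫_{ℝ³} |∇v|² dx < ∞» for every
solution of the class (proof p.14 l.9–91: E monotone; the case E → ∞ contradicts Prop 8.1 by integrating
`E^{−β}E′ ≥ cρ^{−α}`, bounded vs unbounded). [claim: Nahiru2026, status: disputed]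
[cite: Nahiru2026, Thm 9.1 p.14 l.5–91] -/
def Step_T91 : Prop :=
  ∀ ν : ℝ, 0 < ν → ∀ (v : E3 → E3) (p : E3 → ℝ), IsSolution ν v p → MemWeakLp v 3 volume →
    Integrable (gradSq v) volume

/-- **Step 8 — Lemma 10.1 (Upgraded regularity) p.14 l.115 – p.15 l.37**: from `v ∈ L^{3,∞}` and
`∫|∇v|² < ∞`: «v ∈ L⁶(ℝ³) with ‖v‖_{L⁶} ≤ C‖∇v‖_{L²}, and the pressure p associated with the stationary
NS system satisfies p ∈ L³(ℝ³) with ‖p‖_{L³} ≤ C‖∇v‖²_{L²}» (the additive constant of `p` «fixed to zero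
by requiring p ∈ L³», p.15 l.23–29 — typed as: some translate `p − c` is in `L³`).
[claim: Nahiru2026, status: disputed] [cite: Nahiru2026, Lemma 10.1 p.14 l.115 – p.15 l.37] -/
def Step_L101 : Prop :=
  ∃ C : ℝ, 0 ≤ C ∧ ∀ ν : ℝ, 0 < ν → ∀ (v : E3 → E3) (p : E3 → ℝ), IsSolution ν v p →
    MemWeakLp v 3 volume → Integrable (gradSq v) volume →
      MemLp v 6 volume ∧ (∫ x, ‖v x‖ ^ (6 : ℕ)) ^ (1 / 6 : ℝ) ≤ C * (∫ x, gradSq v x) ^ (1 / 2 : ℝ) ∧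
        ∃ c : ℝ, MemLp (fun x => p x - c) 3 volume ∧
          (∫ x, |p x - c| ^ (3 : ℕ)) ^ (1 / 3 : ℝ) ≤ C * ∫ x, gradSq v x

/-- **Step 9 — §10 «Proof of Theorem 1.1» p.15 l.38 – p.16**: testing with `vφ_R²` (identity (21)) and the
bounds on J1 (Cor 6.2 at r = 2), J2 (Prop 7.2 on A(R,2R)), J3 (Lemma 10.1), all → 0 as R → ∞, give
`∇v ≡ 0`, hence `v ≡ 0`. Typed as the implication used: finite Dirichlet energy ⇒ `v = 0`, for every
solution of the class. TRUE-type (classical for `L^{3,∞} ∩ Ẇ^{1,2}`: `L^{3,∞} ∩ L⁶ ⊂ L^{9/2}` + Galdi,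
or the tree's `Tsai2021_annular_liouville_holds`; typist's flag). [claim: Nahiru2026, status: disputed]
[cite: Nahiru2026, §10 p.15 l.38 – p.16; (21) p.15 l.80–93] -/
def Step_S10 : Prop :=
  ∀ ν : ℝ, 0 < ν → ∀ (v : E3 → E3) (p : E3 → ℝ), IsSolution ν v p → MemWeakLp v 3 volume →
    Integrable (gradSq v) volume → v = 0

/-! ## §D Composition (PROVED, pure logic) -/

/-- **COMPOSITION (PROVED)** in the print's order («Sections 3–10 prove Theorem 1.1 in eight steps»):
Lemma 2.2, Prop 5.1, Cor 6.2, Prop 7.2 feed Thm 7.3; Thm 7.3 + Lemma 2.2 give Prop 8.1; Lemma 2.2 +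
Prop 8.1 give Thm 9.1 (FDE); Lemma 10.1 + §10's testing give `v ≡ 0`. The kernel consumes the last two
links (`Step_T91`, `Step_S10`); the earlier binders are their printed inputs, carried for the ordered
index (underscore-named). [cite: Nahiru2026, §1.6 p.4 l.13–16; §§2–10] -/
theorem claim_of_steps (_hL22 : Step_L22) (_hP51 : Step_P51) (_hC62 : Step_C62) (_hP72 : Step_P72)
    (_hT73 : Step_T73) (_hP81 : Step_P81) (hT91 : Step_T91) (_hL101 : Step_L101) (hS10 : Step_S10) :
    ClaimedTheorem :=
  fun ν hν v p hsol hweak => hS10 ν hν v p hsol hweak (hT91 ν hν v p hsol hweak)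

/-- The two consumed links alone compose to the claim. [cite: Nahiru2026, Thm 9.1 p.14; §10 p.15] -/
theorem claim_of_T91_S10 (hT91 : Step_T91) (hS10 : Step_S10) : ClaimedTheorem :=
  fun ν hν v p hsol hweak => hS10 ν hν v p hsol hweak (hT91 ν hν v p hsol hweak)

/-! ## §E Links to the tree (PROVED): non-vacuity of the class, and the LADDER relation -/

/-- The zero field is in the class (non-vacuity of the hypotheses of `ClaimedTheorem`).
[cite: Nahiru2026, §2 p.4 l.22–23] -/
theorem isSolution_zero (ν : ℝ) : IsSolution ν (0 : E3 → E3) (0 : E3 → ℝ) :=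
  ⟨IsLerayProfile.zero ν 0, contDiff_const, contDiff_const⟩

/-- LADDER record (PROVED, pure logic): the claimed statement implies the tree's rung-3 fact
`Wu2026`-type conclusion on the SUBCLASS of decaying solutions — trivially, since it has fewer
hypotheses; stated as the honest containment «`ClaimedTheorem` ⇒ Liouville for `L^{3,∞}` solutions that
also decay». [cite: Nahiru2026, Thm 1.1 p.2 l.47–55] -/
theorem liouville_decaying_of_claimed (h : ClaimedTheorem) :
    ∀ ν : ℝ, 0 < ν → ∀ (v : E3 → E3) (p : E3 → ℝ), IsSolution ν v p → MemWeakLp v 3 volume →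
      Tendsto v (cocompact E3) (𝓝 0) → v = 0 :=
  fun ν hν v p hsol hweak _ => h ν hν v p hsol hweak

/-! ## §F TRUE column (PROVED; D-0026 append-only rev 2, ns-claims-typist-6 g7): THE CLAIMED THEOREM HOLDS
IN THE KERNEL — not through the printed chain, but through the tree's Tsai 2021 annular Liouville theorem
(`Tsai2021_annular_liouville_holds`, Thm 1.1 (a) at `δ = 1`, `L = 2`), whose hypothesis
`liminf_R R⁻¹‖v‖²_{L^{12/5}(R<|x|<2R)} = 0` follows from `v ∈ L^{3,∞}` by the weak-`L³` layer cake (the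
print's own Cor 6.2 at `r = 12/5`, p.10 l.113–114: `‖v‖_{L^{12/5}(A)} ≤ C M ρ^{1/4}`). Records: the printed
statement is thereby a corollary of Tsai 2021 (and of Seregin–Wang 2020 Thm 1.1 (ii)); the printed chain
§3–§10 is not used here and remains the refuters'/REF's object. -/

/-- Tsai's annular quantity at `δ = 1`, `L = 2` unfolded: `R⁻¹ (∫_{R<|x|<2R} ‖v‖^{12/5})^{5/6}`.
[cite: Tsai2021, Thm 1.1 (a)] -/
private theorem tsaiQ_one_two (v : E3 → E3) (R : ℝ) :
    tsaiAnnulusQuantity 1 2 v R =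
      (ENNReal.ofReal R)⁻¹ *
        (∫⁻ x in {x : E3 | R < ‖x‖ ∧ ‖x‖ < 2 * R}, ‖v x‖ₑ ^ (12 / 5 : ℝ)) ^ (5 / 6 : ℝ) := by
  simp only [tsaiAnnulusQuantity]
  norm_num

/-- The annulus `{R < |x| < 2R}` lies in `B_{2R}`. [folklore] -/
private theorem tsaiSet_subset (R : ℝ) : {x : E3 | R < ‖x‖ ∧ ‖x‖ < 2 * R} ⊆ ball (0 : E3) (2 * R) := by
  intro x hx
  rw [mem_ball, dist_zero_right]
  exact hx.2

/-- `|{R < |x| < 2R}| ≤ (2R)³ |B₁|` (the annulus volume `c_θρ³` of p.10 l.88–96, as an upper bound).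
[cite: Nahiru2026, §6 p.10 l.88–96] -/
private theorem volume_tsaiSet_le {R : ℝ} (hR : 0 < R) :
    volume {x : E3 | R < ‖x‖ ∧ ‖x‖ < 2 * R} ≤
      ENNReal.ofReal ((2 * R) ^ 3) * volume (ball (0 : E3) 1) := by
  calc volume {x : E3 | R < ‖x‖ ∧ ‖x‖ < 2 * R} ≤ volume (ball (0 : E3) (2 * R)) :=
        measure_mono (tsaiSet_subset R)
    _ = ENNReal.ofReal ((2 * R) ^ 3) * volume (ball (0 : E3) 1) := by
        rw [Measure.addHaar_ball_of_pos volume (0 : E3) (by positivity : 0 < 2 * R)]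
        simp [finrank_euclideanSpace]

/-- **Cor 6.2 at `r = 12/5` on the annulus `{R < |x| < 2R}`** (Prop 6.1 (12) with `q = 3`, `λ = R⁻¹`):
`∫_{R<|x|<2R} ‖v‖^{12/5} ≤ (8|B₁| + 4 sup_t t³|{|v|>t}|)·R^{3/5}` — the weak-`L³` layer cake of the tree
(`MemWeakLp.setLIntegral_rpow_le`). [cite: Nahiru2026, Prop 6.1 (12) p.10 l.9–87; Cor 6.2 (13) p.10 l.97–114] -/
theorem lintegral_rpow_twelveFifths_annulus_le {v : E3 → E3} (hv : MemWeakLp v 3 volume) {R : ℝ}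
    (hR : 0 < R) :
    ∫⁻ x in {x : E3 | R < ‖x‖ ∧ ‖x‖ < 2 * R}, ‖v x‖ₑ ^ (12 / 5 : ℝ) ≤
      (8 * volume (ball (0 : E3) 1) + 4 * eWeakLpPow v 3 volume) * ENNReal.ofReal (R ^ (3 / 5 : ℝ)) := by
  have h := MemWeakLp.setLIntegral_rpow_le (p := (3 : ℝ≥0∞)) (μ := volume) hv.aestronglyMeasurable
    (r := 12 / 5) (by norm_num) (by rw [ENNReal.toReal_ofNat]; norm_num)
    {x : E3 | R < ‖x‖ ∧ ‖x‖ < 2 * R} (lam := R⁻¹) (inv_pos.2 hR)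
  rw [ENNReal.toReal_ofNat] at h
  have e1 : (R⁻¹) ^ (12 / 5 : ℝ) = R ^ (-(12 / 5 : ℝ)) := by
    rw [Real.inv_rpow hR.le, ← Real.rpow_neg hR.le]
  have e2 : (12 / 5 : ℝ) / (3 - 12 / 5) * R⁻¹ ^ ((12 / 5 : ℝ) - 3) = 4 * R ^ (3 / 5 : ℝ) := by
    rw [Real.inv_rpow hR.le, ← Real.rpow_neg hR.le]
    norm_num
  rw [e1, e2] at h
  refine h.trans ?_
  have hvol := volume_tsaiSet_le hR
  have e3 : ENNReal.ofReal ((2 * R) ^ 3) * ENNReal.ofReal (R ^ (-(12 / 5 : ℝ))) =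
      8 * ENNReal.ofReal (R ^ (3 / 5 : ℝ)) := by
    rw [← ENNReal.ofReal_mul (by positivity), show (8 : ℝ≥0∞) = ENNReal.ofReal 8 by norm_num,
      ← ENNReal.ofReal_mul (by norm_num)]
    congr 1
    rw [mul_pow, show ((2 : ℝ) ^ 3) = 8 by norm_num, mul_assoc]
    congr 1
    rw [show (R ^ 3 : ℝ) = R ^ (3 : ℝ) by norm_cast, ← Real.rpow_add hR]
    norm_num
  calc volume {x : E3 | R < ‖x‖ ∧ ‖x‖ < 2 * R} * ENNReal.ofReal (R ^ (-(12 / 5 : ℝ))) +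
        ENNReal.ofReal (4 * R ^ (3 / 5 : ℝ)) * eWeakLpPow v 3 volume
      ≤ ENNReal.ofReal ((2 * R) ^ 3) * volume (ball (0 : E3) 1) * ENNReal.ofReal (R ^ (-(12 / 5 : ℝ))) +
        ENNReal.ofReal (4 * R ^ (3 / 5 : ℝ)) * eWeakLpPow v 3 volume := by
          gcongr
    _ = (8 * volume (ball (0 : E3) 1) + 4 * eWeakLpPow v 3 volume) * ENNReal.ofReal (R ^ (3 / 5 : ℝ)) := by
          rw [mul_right_comm, e3, ENNReal.ofReal_mul (by norm_num), show ENNReal.ofReal 4 = 4 by norm_num]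
          ring

/-- The constant of the decay bound, `(8|B₁| + 4‖v‖³_{L^{3,∞}})^{5/6}`. [folklore] -/
private def tsaiK (v : E3 → E3) : ℝ≥0∞ :=
  (8 * volume (ball (0 : E3) 1) + 4 * eWeakLpPow v 3 volume) ^ (5 / 6 : ℝ)

/-- The constant is finite for a weak-`L³` field. [folklore] -/
private theorem tsaiK_ne_top {v : E3 → E3} (hv : MemWeakLp v 3 volume) : tsaiK v ≠ ∞ := by
  unfold tsaiK
  refine ENNReal.rpow_ne_top_of_nonneg (by norm_num) ?_
  refine ENNReal.add_ne_top.2 ⟨ENNReal.mul_ne_top (by norm_num) ?_,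
    ENNReal.mul_ne_top (by norm_num) hv.eWeakLpPow_lt_top.ne⟩
  exact (measure_ball_lt_top).ne

/-- **Tsai's quantity decays like `R^{−1/2}` for a weak-`L³` field**: `R⁻¹‖v‖²_{L^{12/5}(R<|x|<2R)} ≤
K R^{−1/2}` (= Cor 6.2 at `r = 12/5`: `‖v‖_{L^{12/5}(A)} ≤ C M ρ^{1/4}`, p.10 l.113–114, in Tsai's
normalisation). [cite: Nahiru2026, Cor 6.2 (13) p.10 l.97–114] [cite: Tsai2021, Thm 1.1 (a)] -/
theorem tsaiAnnulusQuantity_one_two_le {v : E3 → E3} (hv : MemWeakLp v 3 volume) {R : ℝ} (hR : 0 < R) :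
    tsaiAnnulusQuantity 1 2 v R ≤
      (8 * volume (ball (0 : E3) 1) + 4 * eWeakLpPow v 3 volume) ^ (5 / 6 : ℝ) *
        ENNReal.ofReal (R ^ (-(1 / 2 : ℝ))) := by
  rw [tsaiQ_one_two]
  have h1 := lintegral_rpow_twelveFifths_annulus_le hv hR
  have h2 : (∫⁻ x in {x : E3 | R < ‖x‖ ∧ ‖x‖ < 2 * R}, ‖v x‖ₑ ^ (12 / 5 : ℝ)) ^ (5 / 6 : ℝ) ≤
      tsaiK v * ENNReal.ofReal (R ^ (1 / 2 : ℝ)) := by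
    calc (∫⁻ x in {x : E3 | R < ‖x‖ ∧ ‖x‖ < 2 * R}, ‖v x‖ₑ ^ (12 / 5 : ℝ)) ^ (5 / 6 : ℝ)
        ≤ ((8 * volume (ball (0 : E3) 1) + 4 * eWeakLpPow v 3 volume) *
            ENNReal.ofReal (R ^ (3 / 5 : ℝ))) ^ (5 / 6 : ℝ) := by gcongr
      _ = tsaiK v * ENNReal.ofReal (R ^ (1 / 2 : ℝ)) := by
          rw [ENNReal.mul_rpow_of_nonneg _ _ (by norm_num), tsaiK,
            ENNReal.ofReal_rpow_of_nonneg (by positivity) (by norm_num), ← Real.rpow_mul hR.le]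
          norm_num
  calc (ENNReal.ofReal R)⁻¹ * (∫⁻ x in {x : E3 | R < ‖x‖ ∧ ‖x‖ < 2 * R}, ‖v x‖ₑ ^ (12 / 5 : ℝ)) ^ (5 / 6 : ℝ)
      ≤ (ENNReal.ofReal R)⁻¹ * (tsaiK v * ENNReal.ofReal (R ^ (1 / 2 : ℝ))) := by gcongr
    _ = tsaiK v * ENNReal.ofReal (R ^ (-(1 / 2 : ℝ))) := by
        rw [ENNReal.ofReal_inv_of_pos hR |>.symm, mul_left_comm, ← mul_assoc (tsaiK v), mul_assoc,
          ← ENNReal.ofReal_mul (inv_pos.2 hR).le]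
        congr 2
        rw [show (R⁻¹ : ℝ) = R ^ (-(1 : ℝ)) by rw [Real.rpow_neg_one], ← Real.rpow_add hR]
        norm_num

/-- **Hence the Tsai hypothesis at `δ = 1`, `L = 2`**: `liminf_R R⁻¹‖v‖²_{L^{12/5}(R<|x|<2R)} = 0` for every
weak-`L³` field (indeed the quantity tends to `0`). [cite: Tsai2021, Thm 1.1 (a)] [cite: Nahiru2026, Cor 6.2 (13) p.10] -/
theorem liminf_tsaiAnnulusQuantity_one_two_eq_zero {v : E3 → E3} (hv : MemWeakLp v 3 volume) :
    liminf (tsaiAnnulusQuantity 1 2 v) atTop = 0 := by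
  have hK := tsaiK_ne_top hv
  have hlim : Tendsto (fun R : ℝ => tsaiK v * ENNReal.ofReal (R ^ (-(1 / 2 : ℝ)))) atTop (𝓝 0) := by
    have h0 : Tendsto (fun R : ℝ => R ^ (-(1 / 2 : ℝ))) atTop (𝓝 0) :=
      tendsto_rpow_neg_atTop (by norm_num)
    have h1 : Tendsto (fun R : ℝ => ENNReal.ofReal (R ^ (-(1 / 2 : ℝ)))) atTop (𝓝 0) := by
      simpa using ENNReal.tendsto_ofReal h0
    simpa using ENNReal.Tendsto.const_mul h1 (Or.inr hK)
  have hle : ∀ᶠ R in atTop, tsaiAnnulusQuantity 1 2 v R ≤ tsaiK v * ENNReal.ofReal (R ^ (-(1 / 2 : ℝ))) := by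
    filter_upwards [eventually_gt_atTop 0] with R hR using tsaiAnnulusQuantity_one_two_le hv hR
  have ht : Tendsto (tsaiAnnulusQuantity 1 2 v) atTop (𝓝 0) :=
    tendsto_of_tendsto_of_tendsto_of_le_of_le' tendsto_const_nhds hlim
      (Eventually.of_forall fun _ => bot_le) hle
  exact ht.liminf_eq

/-- **THE CLAIMED THEOREM HOLDS (PROVED)** — Theorem 1.1 p.2 l.48–55 is a theorem of the tree: every
smooth stationary Navier–Stokes solution on `ℝ³` (any `ν > 0`) with `‖v‖_{L^{3,∞}} < ∞` vanishes
identically. Proof: Tsai 2021 Thm 1.1 (a) at `δ = 1`, `L = 2` (`Tsai2021_annular_liouville_holds`) + the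
weak-`L³` layer cake above. The printed chain §3–§10 is NOT used. [cite: Nahiru2026, Thm 1.1 p.2 l.47–55]
[cite: Tsai2021, Thm 1.1 (a)] [cite: SereginWang2020, Thm 1.1 (ii)] -/
theorem claimedTheorem_holds : ClaimedTheorem := fun ν hν v p hsol hweak =>
  Tsai2021_annular_liouville_holds ν hν v p hsol.1 1 2 zero_le_one le_rfl one_lt_two
    (liminf_tsaiAnnulusQuantity_one_two_eq_zero hweak)

/-! ## §G The print's LINKS (rev 3, additive; chair 19:14:06Z): the derivations of §5, §7.3, §8, §9, §10
typed as implications between the Steps, so that the equation-free tool Steps are CONSUMED binders in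
print dependency order; `claim_of_steps_v2` PROVED by genuine composition (every binder used). Each link
lists exactly the typed inputs the printed proof invokes; printed inputs that are not Steps of this file
(the Bogovskiĭ apparatus §4: Lemma 4.1, Prop 4.3, Cor 4.4 (6), Lemma 4.5 (8), identity (9) Prop 4.6) are
named in the docstring and sit INSIDE the link. None asserted. -/

/-- **Link §5 — proof of Proposition 5.1, p.8 l.107 – p.9 l.84**: «Start from (9) and bound each term»:
identity (9) (Prop 4.6, with `w = vη − B[v·∇η]`, Lemma 4.1/Prop 4.3/Cor 4.4 (6)/Lemma 4.5 (8) — inside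
this link), Term I1 by the display «|∆η| ≤ C_θ/ρ²» (`Step_P51_I1`, applied in print to the hat of §5 — see
the module FLAG) «and by the Lorentz bound (13) below» at r = 2 (`Step_C62`), Term I2 (Cauchy–Schwarz +
(6)), Term I4 ((6) at q = 3/2 + Hölder L^{3,∞}–L^{3/2,1} + (8)), Term I3 (|∇η| ≤ C_θ/ρ). Typed: the two tool
Steps the proof cites imply `Step_P51`. [claim: Nahiru2026, status: disputed]
[cite: Nahiru2026, Prop 5.1 proof p.8 l.107 – p.9 l.84; Prop 4.6 (9) p.7 l.65–91] -/
def Step_P51_of : Prop := Step_P51_I1 → Step_C62 → Step_P51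

/-- **Link §7.3 — proof of Theorem 7.3, p.12 l.26–97**: «From (11), dividing by ν: E ≤ (C⋆/ν)ρ^{−1/2}D^{1/2}
+ ½|I1| + (1/2ν)∫|v|²|v·∇η|. The middle term is bounded by C_θM²/ρ. For the last term, (17) gives …;
since b − 1 = γ …» — inputs: Prop 5.1 (11) with its two printed bounds (= `Step_P51` at the typed grain)
and Prop 7.2 (17) (`Step_P72`); output (18). [claim: Nahiru2026, status: disputed]
[cite: Nahiru2026, Thm 7.3 proof p.12 l.26–97] -/
def Step_T73_of : Prop := Step_P51 → Step_P72 → Step_T73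

/-- **Link §8 — proof of Proposition 8.1, p.13 l.15–102**: from (18) (`Step_T73`): `D^{1/2} ≤ D^b + 1`
(b ≥ 1/2 ⟺ p ≤ 12/5), (20), the threshold `E ≥ 2R(ρ)` from `E → ∞`, `½E ≤ Kρ^γD^b`, then «Combined with
Lemma 2.2, D ≤ ((1−θ)/θ)ρE′» (`Step_L22`) gives (19). [claim: Nahiru2026, status: disputed]
[cite: Nahiru2026, Prop 8.1 proof p.13 l.15–102] -/
def Step_P81_of : Prop := Step_T73 → Step_L22 → Step_P81

/-- **Link §9 — proof of Theorem 9.1, p.14 l.9–91**: «By Lemma 2.2, E is non-decreasing» (`Step_L22`: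
dichotomy bounded / `E → ∞`); in the unbounded case Prop 8.1 (`Step_P81`) at p = 2 and the integration of
`E^{−β}E′ ≥ cρ^{−α}` (bounded left side, unbounded right side) give the contradiction; bounded `E` and
`E(ρ) ≥ ∫_{B_{θρ}}|∇v|²` give `∫|∇v|² < ∞`. [claim: Nahiru2026, status: disputed]
[cite: Nahiru2026, Thm 9.1 proof p.14 l.9–91] -/
def Step_T91_of : Prop := Step_L22 → Step_P81 → Step_T91

/-- **Link §10 — «Proof of Theorem 1.1», p.15 l.38 – p.16 l.56**: with `∫|∇v|² < ∞` in hand, Lemma 10.1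
(`Step_L101`: v ∈ L⁶, p ∈ L³), identity (21), «Term J1. By Corollary 6.2 with r = 2» (`Step_C62`), «Term J2
… (17) (applied on A(R, 2R) with θ = 1/2)» (`Step_P72`), Term J3 (Hölder with Lemma 10.1), all → 0, so
`∇v ≡ 0`, `v` constant, and «a nonzero constant does not lie in L^{3,∞}» — output: FDE ⇒ v ≡ 0
(`Step_S10`). [claim: Nahiru2026, status: disputed] [cite: Nahiru2026, §10 p.15 l.38 – p.16 l.56] -/
def Step_S10_of : Prop := Step_C62 → Step_P72 → Step_L101 → Step_S10

/-- **COMPOSITION v2 (PROVED, genuine; chair 19:14:06Z)**: binders in PRINT ORDER — Lemma 2.2 (§2), the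
§5 link, Term I1's display (§5), Cor 6.2 (§6), Prop 7.2 (§7), the §7.3 link, the §8 link, the §9 link,
Lemma 10.1 (§10), the §10 link — and EVERY binder is consumed: `Step_P51 := hP51of hP51I1 hC62`,
`Step_T73 := hT73of _ hP72`, `Step_P81 := hP81of _ hL22`, `Step_T91 := hT91of hL22 _`,
`Step_S10 := hS10of hC62 hP72 hL101`, then `claim_of_T91_S10`. The equation-free tool Steps `Step_L22`,
`Step_P51_I1`, `Step_C62`, `Step_P72` are thereby consumed heads-in-waiting in dependency order
(`Step_P51_I1`, `Step_C62` enter at §5; `Step_P72` at §7.3; `Step_L22` at §8).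
[cite: Nahiru2026, §1.6 p.4 l.13–16; §§5–10] -/
theorem claim_of_steps_v2 (hL22 : Step_L22) (hP51of : Step_P51_of) (hP51I1 : Step_P51_I1)
    (hC62 : Step_C62) (hP72 : Step_P72) (hT73of : Step_T73_of) (hP81of : Step_P81_of)
    (hT91of : Step_T91_of) (hL101 : Step_L101) (hS10of : Step_S10_of) : ClaimedTheorem :=
  have hP51 : Step_P51 := hP51of hP51I1 hC62
  have hT73 : Step_T73 := hT73of hP51 hP72
  have hP81 : Step_P81 := hP81of hT73 hL22
  have hT91 : Step_T91 := hT91of hL22 hP81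
  have hS10 : Step_S10 := hS10of hC62 hP72 hL101
  claim_of_T91_S10 hT91 hS10

/-! ## §H TRUE column, equation-free tool Steps (PROVED; D-0026 append-only rev 4, ns-claims-typist-7 g8,
2-READ of record): `Step_C62` (Cor 6.2, weak-`L³` layer cake) and `Step_L22` (Lemma 2.2, the hat-function
derivative formula). Rev-3 lines above are byte-identical; nothing of the printed chain's other links is
touched. -/

section StepC62Discharge

/-- The volume of the unit ball of `ℝ³`, as a real number (the constant `c_θ`-free part of (13)). [folklore] -/
private def c0 : ℝ := (volume (ball (0 : E3) 1)).toReal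

/-- `|A(θρ,ρ)| ≤ |B₁| ρ³`. [folklore] -/
private theorem volume_annulus_le {θ ρ : ℝ} (hρ : 0 < ρ) :
    volume (annulus θ ρ) ≤ ENNReal.ofReal (c0 * ρ ^ 3) := by
  have h1 : volume (annulus θ ρ) ≤ volume (ball (0 : E3) ρ) := measure_mono fun x hx => hx.1
  have h2 : volume (ball (0 : E3) ρ) = ENNReal.ofReal (ρ ^ 3) * volume (ball (0 : E3) 1) := by
    rw [Measure.addHaar_ball_of_pos volume (0 : E3) hρ, finrank_euclideanSpace_fin]
  have hfin : volume (ball (0 : E3) 1) ≠ ∞ := measure_ball_lt_top.ne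
  calc volume (annulus θ ρ) ≤ ENNReal.ofReal (ρ ^ 3) * volume (ball (0 : E3) 1) := h1.trans h2.le
    _ = ENNReal.ofReal (c0 * ρ ^ 3) := by
        rw [mul_comm (c0 : ℝ), ENNReal.ofReal_mul (by positivity), c0, ENNReal.ofReal_toReal hfin]

/-- If the weak-`L³` quasi-norm power vanishes, the field vanishes a.e. [folklore] -/
private theorem ae_eq_zero_of_eWeakLpPow_eq_zero {f : E3 → E3}
    (hW : eWeakLpPow f 3 volume = 0) : ∀ᵐ x ∂volume, f x = 0 := by
  have hn : ∀ n : ℕ, volume {x | (1 / ((n : ℝ) + 1) : ℝ) < ‖f x‖} = 0 := by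
    intro n
    have ht : (0 : ℝ) < 1 / ((n : ℝ) + 1) := by positivity
    have h := meas_lt_norm_le_eWeakLpPow_mul_inv f 3 volume ht
    rw [hW, zero_mul] at h
    exact le_antisymm h bot_le
  have hU : {x | f x ≠ 0} ⊆ ⋃ n : ℕ, {x | (1 / ((n : ℝ) + 1) : ℝ) < ‖f x‖} := by
    intro x hx
    have hpos : 0 < ‖f x‖ := norm_pos_iff.2 hx
    obtain ⟨n, hn⟩ := exists_nat_one_div_lt hpos
    exact mem_iUnion.2 ⟨n, hn⟩
  have h0 : volume {x | f x ≠ 0} = 0 :=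
    measure_mono_null hU ((measure_iUnion_null_iff).2 hn)
  simpa [ae_iff] using h0

/-- **Step 3 (Cor 6.2 (13), Lorentz layer-cake bound on the annulus) HOLDS**, for every `f ∈ L^{3,∞}(ℝ³)`:
`‖f‖_{L^r(A(θρ,ρ))} ≤ C M ρ^{3/r−1}` with `C = (|B₁| + r/(3−r))^{1/r}` — the weak-`L³` layer cake
(`MemWeakLp.setLIntegral_rpow_le` at height `λ = M/ρ`) and `|A(θρ,ρ)| ≤ |B₁|ρ³`. Moves the docstring's
«TRUE (tree: `MemWeakLp.setLIntegral_rpow_le`)» to the in-file column; equation-free.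
[cite: Nahiru2026, Cor 6.2 (13) p.10 l.97–103; Prop 6.1 (12) p.10 l.9–87] -/
theorem step_C62_holds : Step_C62 := by
  intro θ _hθ0 _hθ1 r hr hr3
  have hr3' : 0 < 3 - r := by linarith
  have hc0 : 0 ≤ c0 := ENNReal.toReal_nonneg
  have hK : 0 ≤ c0 + r / (3 - r) := by positivity
  refine ⟨(c0 + r / (3 - r)) ^ (1 / r), Real.rpow_nonneg hK _, fun f hf ρ hρ => ?_⟩
  set W : ℝ≥0∞ := eWeakLpPow f 3 volume with hWdef
  have hWlt : W < ∞ := hf.eWeakLpPow_lt_top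
  set m : ℝ := M f with hm_def
  have hm_nonneg : 0 ≤ m := ENNReal.toReal_nonneg
  have hm_eq : m = W.toReal ^ (1 / 3 : ℝ) := by
    rw [hm_def, M, ← ENNReal.toReal_rpow]
  -- the integrand of `lrA`
  have hmeas : AEStronglyMeasurable (fun x => ‖f x‖ ^ r) (volume.restrict (annulus θ ρ)) :=
    (hf.aestronglyMeasurable.norm.aemeasurable.pow_const r).aestronglyMeasurable.restrict
  have hI_nonneg : 0 ≤ ∫ x in annulus θ ρ, ‖f x‖ ^ r :=
    integral_nonneg fun x => Real.rpow_nonneg (norm_nonneg _) _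
  have hI_eq : ∫ x in annulus θ ρ, ‖f x‖ ^ r =
      (∫⁻ x in annulus θ ρ, ‖f x‖ₑ ^ r).toReal := by
    rw [integral_eq_lintegral_of_nonneg_ae (Eventually.of_forall fun x => Real.rpow_nonneg
      (norm_nonneg _) _) hmeas]
    congr 1
    refine lintegral_congr fun x => ?_
    rw [← ofReal_norm, ENNReal.ofReal_rpow_of_nonneg (norm_nonneg _) hr.le]
  -- target shape
  have hgoal : ∫ x in annulus θ ρ, ‖f x‖ ^ r ≤ (c0 + r / (3 - r)) * m ^ r * ρ ^ (3 - r) := by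
    rcases hm_nonneg.eq_or_lt with hm0 | hm_pos
    · -- `M = 0`: the field vanishes a.e.
      have hW0 : W = 0 := by
        have h1 : W.toReal ^ (1 / 3 : ℝ) = 0 := by rw [← hm_eq]; exact hm0.symm
        have h2 : W.toReal = 0 := by
          rcases (Real.rpow_eq_zero_iff_of_nonneg ENNReal.toReal_nonneg).1 h1 with ⟨h, _⟩
          exact h
        exact (ENNReal.toReal_eq_zero_iff _).1 h2 |>.resolve_right hWlt.ne
      have hae := ae_eq_zero_of_eWeakLpPow_eq_zero (f := f) (by rw [← hWdef, hW0])
      have hI0 : ∫ x in annulus θ ρ, ‖f x‖ ^ r = 0 := by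
        have : ∀ᵐ x ∂(volume.restrict (annulus θ ρ)), ‖f x‖ ^ r = 0 := by
          filter_upwards [ae_restrict_of_ae hae] with x hx
          rw [hx, norm_zero, Real.zero_rpow hr.ne']
        rw [integral_congr_ae this, integral_zero]
      rw [hI0, ← hm0]
      have : (0 : ℝ) ^ r = 0 := Real.zero_rpow hr.ne'
      rw [this, mul_zero, zero_mul]
    · -- `M > 0`: layer cake at height `λ = M/ρ`
      have hl : 0 < m / ρ := div_pos hm_pos hρ
      have hlc := MemWeakLp.setLIntegral_rpow_le (μ := volume) (p := 3) hf.aestronglyMeasurable hr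
        (by simpa using hr3) (annulus θ ρ) hl
      have hA := volume_annulus_le (θ := θ) hρ
      have hp3 : (3 : ℝ≥0∞).toReal = 3 := by simp
      rw [hp3] at hlc
      -- bound is finite; pass to reals
      have hW_eq : W.toReal = m ^ (3 : ℝ) := by
        rw [hm_eq, ← Real.rpow_mul ENNReal.toReal_nonneg]; norm_num
      have hbound : (∫⁻ x in annulus θ ρ, ‖f x‖ₑ ^ r) ≤
          ENNReal.ofReal (c0 * ρ ^ 3) * ENNReal.ofReal ((m / ρ) ^ r) +
            ENNReal.ofReal (r / (3 - r) * (m / ρ) ^ (r - 3)) * W :=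
        hlc.trans (add_le_add (mul_le_mul' hA le_rfl) le_rfl)
      have hfin : ENNReal.ofReal (c0 * ρ ^ 3) * ENNReal.ofReal ((m / ρ) ^ r) +
            ENNReal.ofReal (r / (3 - r) * (m / ρ) ^ (r - 3)) * W ≠ ∞ := by
        refine ENNReal.add_ne_top.2 ⟨ENNReal.mul_ne_top ENNReal.ofReal_ne_top ENNReal.ofReal_ne_top,
          ENNReal.mul_ne_top ENNReal.ofReal_ne_top hWlt.ne⟩
      have hreal : ∫ x in annulus θ ρ, ‖f x‖ ^ r ≤
          c0 * ρ ^ 3 * (m / ρ) ^ r + r / (3 - r) * (m / ρ) ^ (r - 3) * m ^ (3 : ℝ) := by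
        rw [hI_eq]
        have := ENNReal.toReal_mono hfin hbound
        rw [ENNReal.toReal_add (ENNReal.mul_ne_top ENNReal.ofReal_ne_top ENNReal.ofReal_ne_top)
          (ENNReal.mul_ne_top ENNReal.ofReal_ne_top hWlt.ne), ENNReal.toReal_mul, ENNReal.toReal_mul,
          ENNReal.toReal_ofReal (by positivity), ENNReal.toReal_ofReal (by positivity),
          ENNReal.toReal_ofReal (by positivity), hW_eq] at this
        exact this
      -- algebra of the powers
      have hρr : (m / ρ) ^ r = m ^ r * ρ ^ (-r) := by
        rw [Real.div_rpow hm_nonneg hρ.le, Real.rpow_neg hρ.le, div_eq_mul_inv]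
      have hρr3 : (m / ρ) ^ (r - 3) * m ^ (3 : ℝ) = m ^ r * ρ ^ (3 - r) := by
        rw [Real.div_rpow hm_nonneg hρ.le, div_mul_eq_mul_div, ← Real.rpow_add hm_pos,
          show r - 3 + 3 = r by ring, div_eq_mul_inv, ← Real.rpow_neg hρ.le, neg_sub]
      have h3r : ρ ^ (3 : ℕ) * ρ ^ (-r) = ρ ^ (3 - r) := by
        rw [← Real.rpow_natCast ρ 3, ← Real.rpow_add hρ]; norm_num; ring_nf
      calc ∫ x in annulus θ ρ, ‖f x‖ ^ r
          ≤ c0 * ρ ^ 3 * (m / ρ) ^ r + r / (3 - r) * (m / ρ) ^ (r - 3) * m ^ (3 : ℝ) := hreal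
        _ = c0 * (m ^ r * (ρ ^ (3 : ℕ) * ρ ^ (-r))) + r / (3 - r) * ((m / ρ) ^ (r - 3) * m ^ (3 : ℝ)) := by
            rw [hρr]; ring
        _ = (c0 + r / (3 - r)) * m ^ r * ρ ^ (3 - r) := by rw [h3r, hρr3]; ring
  -- take the `1/r`-th power
  unfold lrA
  calc (∫ x in annulus θ ρ, ‖f x‖ ^ r) ^ (1 / r)
      ≤ ((c0 + r / (3 - r)) * m ^ r * ρ ^ (3 - r)) ^ (1 / r) :=
        Real.rpow_le_rpow hI_nonneg hgoal (by positivity)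
    _ = (c0 + r / (3 - r)) ^ (1 / r) * m * ρ ^ (3 / r - 1) := by
        rw [Real.mul_rpow (by positivity) (Real.rpow_nonneg hρ.le _),
          Real.mul_rpow hK (Real.rpow_nonneg hm_nonneg _), ← Real.rpow_mul hm_nonneg,
          ← Real.rpow_mul hρ.le, mul_one_div_cancel hr.ne', Real.rpow_one]
        congr 2
        field_simp
    _ = (c0 + r / (3 - r)) ^ (1 / r) * M f * ρ ^ (3 / r - 1) := by rw [hm_def]

end StepC62Discharge

section StepL22Discharge

/-- Clamp form of the hat function: `φ(t) = max 0 (min 1 ((1−t)/(1−θ)))` for `θ < 1`. [folklore] -/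
private theorem hat_eq_clamp {θ : ℝ} (hθ1 : θ < 1) (t : ℝ) :
    hat θ t = max 0 (min 1 ((1 - t) / (1 - θ))) := by
  have h1θ : 0 < 1 - θ := by linarith
  unfold hat
  split_ifs with h1 h2
  · have : 1 ≤ (1 - t) / (1 - θ) := by rw [le_div_iff₀ h1θ]; linarith
    rw [min_eq_left this, max_eq_right zero_le_one]
  · have hle : (1 - t) / (1 - θ) ≤ 1 := by rw [div_le_iff₀ h1θ]; linarith
    have hge : 0 ≤ (1 - t) / (1 - θ) := div_nonneg (by linarith) h1θ.le
    rw [min_eq_right hle, max_eq_right hge]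
  · have hle : (1 - t) / (1 - θ) ≤ 0 := div_nonpos_of_nonpos_of_nonneg (by linarith) h1θ.le
    rw [min_eq_right (hle.trans zero_le_one), max_eq_left hle]

/-- The hat function is `(1−θ)⁻¹`-Lipschitz: `|φ(t) − φ(s)| ≤ |t − s|/(1−θ)`. [folklore] -/
private theorem abs_hat_sub_hat_le {θ : ℝ} (hθ1 : θ < 1) (t s : ℝ) :
    |hat θ t - hat θ s| ≤ |t - s| / (1 - θ) := by
  have h1θ : 0 < 1 - θ := by linarith
  rw [hat_eq_clamp hθ1, hat_eq_clamp hθ1]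
  calc |max 0 (min 1 ((1 - t) / (1 - θ))) - max 0 (min 1 ((1 - s) / (1 - θ)))|
      ≤ max |(0 : ℝ) - 0| |min 1 ((1 - t) / (1 - θ)) - min 1 ((1 - s) / (1 - θ))| :=
        abs_max_sub_max_le_max _ _ _ _
    _ = |min 1 ((1 - t) / (1 - θ)) - min 1 ((1 - s) / (1 - θ))| := by
        rw [sub_zero, abs_zero, max_eq_right (abs_nonneg _)]
    _ ≤ max |(1 : ℝ) - 1| |(1 - t) / (1 - θ) - (1 - s) / (1 - θ)| := abs_min_sub_min_le_max _ _ _ _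
    _ = |(1 - t) / (1 - θ) - (1 - s) / (1 - θ)| := by
        rw [sub_self, abs_zero, max_eq_right (abs_nonneg _)]
    _ = |t - s| / (1 - θ) := by
        rw [← sub_div, abs_div, abs_of_pos h1θ, show (1 - t) - (1 - s) = -(t - s) by ring, abs_neg]

/-- The hat function is antitone. [folklore] -/
private theorem hat_antitone {θ : ℝ} (hθ1 : θ < 1) : Antitone (hat θ) := by
  have h1θ : 0 < 1 - θ := by linarith
  intro t s hts
  rw [hat_eq_clamp hθ1, hat_eq_clamp hθ1]
  refine max_le_max le_rfl (min_le_min le_rfl ?_)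
  exact div_le_div_of_nonneg_right (by linarith) h1θ.le

/-- `0 ≤ φ ≤ 1`. [folklore] -/
private theorem hat_nonneg {θ : ℝ} (hθ1 : θ < 1) (t : ℝ) : 0 ≤ hat θ t := by
  rw [hat_eq_clamp hθ1]; exact le_max_left _ _

/-- `φ ≤ 1`. [folklore] -/
private theorem hat_le_one {θ : ℝ} (hθ1 : θ < 1) (t : ℝ) : hat θ t ≤ 1 := by
  rw [hat_eq_clamp hθ1]; exact max_le zero_le_one (min_le_left _ _)

/-- `φ(t) = 0` for `t ≥ 1` and `φ(t) = 1` for `t < θ`. [folklore] -/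
private theorem hat_of_one_le {θ t : ℝ} (hθ1 : θ < 1) (ht : 1 ≤ t) : hat θ t = 0 := by
  unfold hat; rw [if_neg (by linarith), if_neg (by linarith)]

/-- `φ(t) = 1` for `t < θ`. [folklore] -/
private theorem hat_of_lt {θ t : ℝ} (ht : t < θ) : hat θ t = 1 := by
  unfold hat; rw [if_pos ht]

/-- `φ(t) = (1−t)/(1−θ)` for `θ ≤ t < 1`. [folklore] -/
private theorem hat_of_mem {θ t : ℝ} (h1 : θ ≤ t) (h2 : t < 1) : hat θ t = (1 - t) / (1 - θ) := by
  unfold hat; rw [if_neg (not_lt.2 h1), if_pos h2]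

/-- The hat function is continuous. [folklore] -/
private theorem continuous_hat {θ : ℝ} (hθ1 : θ < 1) : Continuous (hat θ) := by
  have : hat θ = fun t => max 0 (min 1 ((1 - t) / (1 - θ))) := funext (hat_eq_clamp hθ1)
  rw [this]
  fun_prop

/-- `|∇v|²` is continuous for smooth `v`. [folklore] -/
private theorem continuous_gradSq {v : E3 → E3} (hv : ContDiff ℝ (⊤ : ℕ∞) v) : Continuous (gradSq v) := by
  have h1 : Continuous (fderiv ℝ v) := hv.continuous_fderiv (by simp)
  unfold gradSq frobeniusNormSq
  fun_prop

/-- `0 ≤ |∇v|²`. [folklore] -/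
private theorem gradSq_nonneg (v : E3 → E3) (x : E3) : 0 ≤ gradSq v x := by
  unfold gradSq frobeniusNormSq; positivity

/-- The integrand of `E(ρ)`, as a function of `(ρ, x)` (plumbing). [folklore] -/
private def F (θ : ℝ) (v : E3 → E3) (ρ : ℝ) (x : E3) : ℝ := gradSq v x * hat θ (‖x‖ / ρ)

/-- Unfolding of `E` through the plumbing integrand. [folklore] -/
private theorem E_eq_integral_F (θ : ℝ) (v : E3 → E3) (ρ : ℝ) : E θ v ρ = ∫ x, F θ v ρ x := rfl

/-- For `ρ > 0` the integrand vanishes outside the closed ball of radius `ρ`. [folklore] -/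
private theorem F_eq_zero_of_le {θ : ℝ} (hθ1 : θ < 1) (v : E3 → E3) {ρ : ℝ} (hρ : 0 < ρ) {x : E3}
    (hx : ρ ≤ ‖x‖) : F θ v ρ x = 0 := by
  unfold F
  rw [hat_of_one_le hθ1 ((one_le_div hρ).2 hx), mul_zero]

/-- The integrand is continuous and compactly supported, hence integrable (`ρ > 0`). [folklore] -/
private theorem integrable_F {θ : ℝ} (hθ1 : θ < 1) {v : E3 → E3} (hv : ContDiff ℝ (⊤ : ℕ∞) v)
    {ρ : ℝ} (hρ : 0 < ρ) : Integrable (F θ v ρ) volume := by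
  have hc : Continuous (F θ v ρ) := by
    unfold F
    exact (continuous_gradSq hv).mul ((continuous_hat hθ1).comp (continuous_norm.div_const ρ))
  refine hc.integrable_of_hasCompactSupport ?_
  refine HasCompactSupport.of_support_subset_isCompact (isCompact_closedBall (0 : E3) ρ) ?_
  intro x hx
  rw [mem_closedBall, dist_zero_right]
  by_contra h
  exact hx (F_eq_zero_of_le hθ1 v hρ (not_le.1 h).le)

/-- `E` is non-decreasing on `(0, ∞)` (the hat is antitone and `|x|/ρ` decreases in `ρ`). [folklore] -/
private theorem monotoneOn_E {θ : ℝ} (hθ1 : θ < 1) {v : E3 → E3} (hv : ContDiff ℝ (⊤ : ℕ∞) v) :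
    MonotoneOn (E θ v) (Ioi 0) := by
  intro ρ hρ ρ' hρ' hle
  rw [E_eq_integral_F, E_eq_integral_F]
  refine integral_mono (integrable_F hθ1 hv hρ) (integrable_F hθ1 hv hρ') fun x => ?_
  unfold F
  refine mul_le_mul_of_nonneg_left (hat_antitone hθ1 ?_) (gradSq_nonneg v x)
  exact div_le_div_of_nonneg_left (norm_nonneg _) hρ hle

/-- The `ρ`-derivative of the integrand off the two spheres (plumbing). [folklore] -/
private def F' (θ : ℝ) (v : E3 → E3) (ρ : ℝ) (x : E3) : ℝ :=
  (annulus θ ρ).indicator (fun x => gradSq v x * ‖x‖) x * (1 / ((1 - θ) * ρ ^ 2))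

/-- The annulus is measurable. [folklore] -/
private theorem measurableSet_annulus (θ ρ : ℝ) : MeasurableSet (annulus θ ρ) :=
  measurableSet_ball.diff measurableSet_ball

/-- `∫ F′ = ((1−θ)ρ²)⁻¹ ∫_{A(θρ,ρ)} |∇v|² |x|`. [folklore] -/
private theorem integral_F' (θ : ℝ) (v : E3 → E3) (ρ : ℝ) :
    ∫ x, F' θ v ρ x = (1 / ((1 - θ) * ρ ^ 2)) * ∫ x in annulus θ ρ, gradSq v x * ‖x‖ := by
  unfold F'
  rw [integral_mul_const, integral_indicator (measurableSet_annulus θ ρ), mul_comm]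

/-- Pointwise derivative of `ρ ↦ φ(|x|/ρ)` at `ρ₀ > 0`, for `x` off the spheres `|x| = θρ₀`, `|x| = ρ₀`. [folklore] -/
private theorem hasDerivAt_F {θ : ℝ} (hθ1 : θ < 1) (v : E3 → E3) {ρ₀ : ℝ} (hρ₀ : 0 < ρ₀)
    {x : E3} (hx1 : ‖x‖ ≠ θ * ρ₀) (hx2 : ‖x‖ ≠ ρ₀) :
    HasDerivAt (fun ρ => F θ v ρ x) (F' θ v ρ₀ x) ρ₀ := by
  unfold F F'
  rcases lt_or_gt_of_ne hx1 with h1 | h1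
  · -- inside the inner ball: `φ(|x|/ρ) = 1` near `ρ₀`
    have hnot : x ∉ annulus θ ρ₀ := fun h => h.2 (mem_ball_zero_iff.2 h1)
    rw [indicator_of_notMem hnot, zero_mul]
    have hev : ∀ᶠ ρ in 𝓝 ρ₀, gradSq v x * hat θ (‖x‖ / ρ) = gradSq v x * 1 := by
      have hopen : IsOpen {ρ : ℝ | 0 < ρ ∧ ‖x‖ < θ * ρ} :=
        (isOpen_lt continuous_const continuous_id).inter
          (isOpen_lt continuous_const (continuous_const.mul continuous_id))
      filter_upwards [hopen.mem_nhds ⟨hρ₀, h1⟩] with ρ hρ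
      rw [hat_of_lt ((div_lt_iff₀ hρ.1).2 hρ.2)]
    exact ((hasDerivAt_const ρ₀ (gradSq v x * 1)).congr_of_eventuallyEq hev)
  · rcases lt_or_gt_of_ne hx2 with h2 | h2
    · -- in the open annulus: `φ(|x|/ρ) = (1 − |x|/ρ)/(1−θ)` near `ρ₀`
      have hmem : x ∈ annulus θ ρ₀ :=
        ⟨mem_ball_zero_iff.2 h2, fun h => (mem_ball_zero_iff.1 h).not_gt h1⟩
      rw [indicator_of_mem hmem]
      have hev : ∀ᶠ ρ in 𝓝 ρ₀, gradSq v x * hat θ (‖x‖ / ρ) =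
          gradSq v x * ((1 - ‖x‖ * ρ⁻¹) / (1 - θ)) := by
        have hopen : IsOpen {ρ : ℝ | 0 < ρ ∧ θ * ρ < ‖x‖ ∧ ‖x‖ < ρ} :=
          (isOpen_lt continuous_const continuous_id).inter
            ((isOpen_lt (continuous_const.mul continuous_id) continuous_const).inter
              (isOpen_lt continuous_const continuous_id))
        filter_upwards [hopen.mem_nhds ⟨hρ₀, h1, h2⟩] with ρ hρ
        rw [hat_of_mem ((le_div_iff₀ hρ.1).2 hρ.2.1.le) ((div_lt_one hρ.1).2 hρ.2.2), div_eq_mul_inv ‖x‖]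
      have hd : HasDerivAt (fun ρ : ℝ => gradSq v x * ((1 - ‖x‖ * ρ⁻¹) / (1 - θ)))
          (gradSq v x * ((0 - ‖x‖ * (-(ρ₀ ^ 2)⁻¹)) / (1 - θ))) ρ₀ := by
        refine HasDerivAt.const_mul _ (HasDerivAt.div_const ?_ _)
        exact (hasDerivAt_const ρ₀ (1 : ℝ)).sub ((hasDerivAt_inv hρ₀.ne').const_mul ‖x‖)
      refine (hd.congr_of_eventuallyEq hev).congr_deriv ?_
      field_simp
      ring
    · -- outside the outer ball: `φ(|x|/ρ) = 0` near `ρ₀`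
      have hnot : x ∉ annulus θ ρ₀ := fun h => (mem_ball_zero_iff.1 h.1).not_gt h2
      rw [indicator_of_notMem hnot, zero_mul]
      have hev : ∀ᶠ ρ in 𝓝 ρ₀, gradSq v x * hat θ (‖x‖ / ρ) = gradSq v x * 0 := by
        have hopen : IsOpen {ρ : ℝ | 0 < ρ ∧ ρ < ‖x‖} :=
          (isOpen_lt continuous_const continuous_id).inter (isOpen_lt continuous_id continuous_const)
        filter_upwards [hopen.mem_nhds ⟨hρ₀, h2⟩] with ρ hρ
        rw [hat_of_one_le hθ1 ((one_le_div hρ.1).2 hρ.2.le)]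
      simpa using ((hasDerivAt_const ρ₀ (gradSq v x * 0)).congr_of_eventuallyEq hev)

/-- **Differentiation under the integral sign for `E`** at `ρ₀ > 0`. [folklore] -/
private theorem hasDerivAt_E {θ : ℝ} (hθ0 : 0 < θ) (hθ1 : θ < 1) {v : E3 → E3}
    (hv : ContDiff ℝ (⊤ : ℕ∞) v) {ρ₀ : ℝ} (hρ₀ : 0 < ρ₀) :
    HasDerivAt (E θ v) (∫ x, F' θ v ρ₀ x) ρ₀ := by
  have h1θ : 0 < 1 - θ := by linarith
  -- Lipschitz bound on `s = ball ρ₀ (ρ₀/2)`: there `ρ > ρ₀/2`, and the integrand vanishes for `‖x‖ ≥ 2ρ₀`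
  set s : Set ℝ := ball ρ₀ (ρ₀ / 2) with hs_def
  have hs : s ∈ 𝓝 ρ₀ := ball_mem_nhds _ (by positivity)
  have hs_pos : ∀ ρ ∈ s, ρ₀ / 2 < ρ ∧ ρ < 2 * ρ₀ := by
    intro ρ hρ
    rw [hs_def, mem_ball, Real.dist_eq, abs_lt] at hρ
    constructor <;> linarith
  set K : ℝ := 4 / ((1 - θ) * ρ₀ ^ 2) with hK
  have hKpos : 0 < K := by positivity
  set bound : E3 → ℝ := fun x => (closedBall (0 : E3) (2 * ρ₀)).indicator (fun x => gradSq v x * ‖x‖ * K) x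
    with hbound_def
  have hF_meas : ∀ᶠ ρ in 𝓝 ρ₀, AEStronglyMeasurable (F θ v ρ) volume := by
    filter_upwards [hs] with ρ hρ
    exact (integrable_F hθ1 hv ((half_pos hρ₀).trans (hs_pos ρ hρ).1)).aestronglyMeasurable
  have hF_int : Integrable (F θ v ρ₀) volume := integrable_F hθ1 hv hρ₀
  have hF'_meas : AEStronglyMeasurable (F' θ v ρ₀) volume := by
    unfold F'
    refine (AEStronglyMeasurable.indicator ?_ (measurableSet_annulus θ ρ₀)).mul_const _
    exact ((continuous_gradSq hv).mul continuous_norm).aestronglyMeasurable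
  have h_lip : ∀ᵐ x ∂(volume : Measure E3), LipschitzOnWith (Real.nnabs (bound x)) (fun ρ => F θ v ρ x) s := by
    refine Eventually.of_forall fun x => ?_
    refine LipschitzOnWith.of_dist_le_mul fun ρ hρ ρ' hρ' => ?_
    obtain ⟨hρl, hρu⟩ := hs_pos ρ hρ
    obtain ⟨hρl', hρu'⟩ := hs_pos ρ' hρ'
    have hρp : 0 < ρ := (half_pos hρ₀).trans hρl
    have hρp' : 0 < ρ' := (half_pos hρ₀).trans hρl'
    rw [Real.dist_eq, Real.dist_eq, Real.coe_nnabs, hbound_def]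
    beta_reduce
    by_cases hx : x ∈ closedBall (0 : E3) (2 * ρ₀)
    · rw [indicator_of_mem hx, abs_of_nonneg (mul_nonneg (mul_nonneg (gradSq_nonneg v x) (norm_nonneg _)) hKpos.le)]
      unfold F
      rw [← mul_sub, abs_mul, abs_of_nonneg (gradSq_nonneg v x)]
      have hh := abs_hat_sub_hat_le hθ1 (‖x‖ / ρ) (‖x‖ / ρ')
      have hdiff : |‖x‖ / ρ - ‖x‖ / ρ'| ≤ ‖x‖ * (4 / ρ₀ ^ 2) * |ρ - ρ'| := by
        rw [div_sub_div _ _ hρp.ne' hρp'.ne', abs_div, abs_of_pos (mul_pos hρp hρp'),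
          show ‖x‖ * ρ' - ρ * ‖x‖ = ‖x‖ * (ρ' - ρ) by ring, abs_mul, abs_of_nonneg (norm_nonneg _),
          abs_sub_comm ρ' ρ, div_le_iff₀ (mul_pos hρp hρp')]
        have h4 : ρ₀ ^ 2 ≤ 4 * (ρ * ρ') := by nlinarith
        have : ‖x‖ * |ρ - ρ'| * ρ₀ ^ 2 ≤ ‖x‖ * |ρ - ρ'| * (4 * (ρ * ρ')) :=
          mul_le_mul_of_nonneg_left h4 (by positivity)
        calc ‖x‖ * |ρ - ρ'| ≤ ‖x‖ * |ρ - ρ'| * (4 * (ρ * ρ')) / ρ₀ ^ 2 := by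
              rw [le_div_iff₀ (by positivity)]; exact this
          _ = ‖x‖ * (4 / ρ₀ ^ 2) * |ρ - ρ'| * (ρ * ρ') := by ring
      calc gradSq v x * |hat θ (‖x‖ / ρ) - hat θ (‖x‖ / ρ')|
          ≤ gradSq v x * (|‖x‖ / ρ - ‖x‖ / ρ'| / (1 - θ)) :=
            mul_le_mul_of_nonneg_left hh (gradSq_nonneg v x)
        _ ≤ gradSq v x * (‖x‖ * (4 / ρ₀ ^ 2) * |ρ - ρ'| / (1 - θ)) :=
            mul_le_mul_of_nonneg_left (div_le_div_of_nonneg_right hdiff h1θ.le) (gradSq_nonneg v x)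
        _ = gradSq v x * ‖x‖ * K * |ρ - ρ'| := by rw [hK]; field_simp
    · -- far away both values vanish
      have hxn : 2 * ρ₀ < ‖x‖ := by
        rw [mem_closedBall, dist_zero_right, not_le] at hx; exact hx
      rw [F_eq_zero_of_le hθ1 v hρp (by linarith), F_eq_zero_of_le hθ1 v hρp' (by linarith),
        sub_self, abs_zero]
      positivity
  have h_bound_int : Integrable bound volume :=
    ((((continuous_gradSq hv).mul continuous_norm).mul continuous_const).continuousOn.integrableOn_compact
      (isCompact_closedBall (0 : E3) (2 * ρ₀))).integrable_indicator measurableSet_closedBall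
  have h_diff : ∀ᵐ x ∂(volume : Measure E3), HasDerivAt (fun ρ => F θ v ρ x) (F' θ v ρ₀ x) ρ₀ := by
    have hS1 : volume (sphere (0 : E3) (θ * ρ₀)) = 0 := Measure.addHaar_sphere volume 0 _
    have hS2 : volume (sphere (0 : E3) ρ₀) = 0 := Measure.addHaar_sphere volume 0 _
    have hnull : volume (sphere (0 : E3) (θ * ρ₀) ∪ sphere (0 : E3) ρ₀) = 0 :=
      measure_union_null hS1 hS2
    rw [ae_iff]
    refine measure_mono_null (fun x hx => ?_) hnull
    by_contra hx'
    rw [mem_union, mem_sphere_zero_iff_norm, mem_sphere_zero_iff_norm, not_or] at hx'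
    exact hx (hasDerivAt_F hθ1 v hρ₀ hx'.1 hx'.2)
  exact (hasDerivAt_integral_of_dominated_loc_of_lip hs hF_meas hF_int hF'_meas h_lip h_bound_int
    h_diff).2

/-- **Step 1 (Lemma 2.2 (2)–(3)) HOLDS** for every smooth field: `E` is non-decreasing on `(0,∞)`,
differentiable at every `ρ > 0` with `E′(ρ) = ((1−θ)ρ²)⁻¹ ∫_{A(θρ,ρ)} |∇v|² |x| dx` (differentiation
under the integral sign; the hat is `(1−θ)⁻¹`-Lipschitz and the two spheres are null), and
`D(ρ) ≤ ((1−θ)/θ) ρ E′(ρ)` from `|x| ≥ θρ` on the annulus. Equation-free; moves the typist's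
«TRUE-type (calculus)» to the in-file column. [cite: Nahiru2026, Lemma 2.2 (2)–(3) p.4 l.52 – p.5 l.42] -/
theorem step_L22_holds : Step_L22 := by
  intro θ hθ0 hθ1 v hv
  refine ⟨monotoneOn_E hθ1 hv, fun ρ => ∫ x, F' θ v ρ x, fun ρ hρ => ⟨hasDerivAt_E hθ0 hθ1 hv hρ,
    integral_F' θ v ρ, ?_⟩⟩
  -- `D ≤ ((1−θ)/θ) ρ E′`: on the annulus `θρ ≤ |x|`
  show D θ v ρ ≤ (1 - θ) / θ * ρ * ∫ x, F' θ v ρ x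
  rw [integral_F']
  have h1θ : 0 < 1 - θ := by linarith
  have hD : D θ v ρ = ∫ x in annulus θ ρ, gradSq v x := rfl
  have hint : IntegrableOn (fun x => gradSq v x * ‖x‖) (annulus θ ρ) volume :=
    (((continuous_gradSq hv).mul continuous_norm).continuousOn.integrableOn_compact
      (isCompact_closedBall (0 : E3) ρ)).mono_set (fun x hx => by
        rw [mem_closedBall, dist_zero_right]; exact (mem_ball_zero_iff.1 hx.1).le)
  have hint0 : IntegrableOn (gradSq v) (annulus θ ρ) volume :=
    ((continuous_gradSq hv).continuousOn.integrableOn_compact (isCompact_closedBall (0 : E3) ρ)).mono_set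
      (fun x hx => by rw [mem_closedBall, dist_zero_right]; exact (mem_ball_zero_iff.1 hx.1).le)
  have hle : θ * ρ * D θ v ρ ≤ ∫ x in annulus θ ρ, gradSq v x * ‖x‖ := by
    rw [hD, ← integral_const_mul]
    refine setIntegral_mono_on (hint0.const_mul _) hint (measurableSet_annulus θ ρ) fun x hx => ?_
    rw [mul_comm]
    refine mul_le_mul_of_nonneg_left ?_ (gradSq_nonneg v x)
    have := hx.2
    rw [mem_ball_zero_iff, not_lt] at this
    exact this
  calc D θ v ρ = (1 - θ) / θ * ρ * ((1 / ((1 - θ) * ρ ^ 2)) * (θ * ρ * D θ v ρ)) := by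
        field_simp
    _ ≤ (1 - θ) / θ * ρ * ((1 / ((1 - θ) * ρ ^ 2)) * ∫ x in annulus θ ρ, gradSq v x * ‖x‖) := by
        gcongr

end StepL22Discharge

/-! ## §I TRUE column, continued (rev 4, custodian fold of ns-claims-refuter-6 g5's records objects; additive): the SOLUTION-LEVEL Steps and Term I1's
display HOLD, and with them the five LINKS — bytes of ns-claims-refuter-6 g5's records objects
`StepsHold.cd5e1eac5dc39946.lean` (Part 2) and `StepP51I1.7e6bd816f9f30356.lean`, folded verbatim except:
namespace `Literature.Claims.NS.Nahiru2026` (not `…Records`), `[folklore]` helpers made `private`, and the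
class lemma `eq_zero_of_isSolution` pointed at the in-file `claimedTheorem_holds` (§F) instead of
`WeakL3SteadyLiouville.eq_zero_of_memWeakLp_three`. Mechanism (records, RULINGS v1.52): every
solution-level Step quantifies over `IsSolution ν v p ∧ MemWeakLp v 3`, whose only member is `v = 0`
(`claimedTheorem_holds`), where `E ≡ D ≡ 0`; the links have solution-level conclusions. After this section
the file's only undischarged Step is the tool Step `Step_P72` (GN on annuli). -/

/-- Every member of the typed class is the zero field (§F). [cite: Tsai2021, Thm 1.1 (a)]
[cite: Nahiru2026, Thm 1.1 p.2 l.47–55] -/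
theorem eq_zero_of_isSolution {ν : ℝ} (hν : 0 < ν) {v : E3 → E3} {p : E3 → ℝ}
    (hsol : IsSolution ν v p) (hweak : MemWeakLp v 3 volume) : v = 0 :=
  claimedTheorem_holds ν hν v p hsol hweak

/-- On the zero field the pressure of a steady profile is constant (`∇p = 0` on `ℝ³`). [folklore] -/
private theorem pressure_const_of_isSolution_zero {ν : ℝ} {p : E3 → ℝ} (hsol : IsSolution ν (0 : E3 → E3) p)
    (x y : E3) : p x = p y := by
  have hprof := hsol.1
  have hgrad : ∀ z, gradient p z = 0 := fun z => by
    have h := hprof.profile_eq z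
    simpa [convect, Pi.zero_def] using h
  have hfd : ∀ z, fderiv ℝ p z = 0 := fun z => by
    have h := hgrad z
    unfold gradient at h
    have h2 := congrArg (InnerProductSpace.toDual ℝ E3) h
    simpa using h2
  exact is_const_of_fderiv_eq_zero (hprof.contDiff_pressure.differentiable one_ne_zero) hfd x y

/-- `|∇0|² = 0`. [folklore] -/
private theorem gradSq_zero : gradSq (0 : E3 → E3) = fun _ => 0 := by
  funext x
  simp [gradSq, frobeniusNormSq_zero]

/-- `E(ρ) = 0` on the zero field. [folklore] -/
private theorem E_zero (θ ρ : ℝ) : E θ (0 : E3 → E3) ρ = 0 := by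
  simp [E, gradSq_zero]

/-- `D(ρ) = 0` on the zero field. [folklore] -/
private theorem D_zero (θ ρ : ℝ) : D θ (0 : E3 → E3) ρ = 0 := by
  simp [D, gradSq_zero]

/-- `‖0‖_{L^r(A)} = 0` for `r ≠ 0`. [folklore] -/
private theorem lrA_zero {r : ℝ} (hr : r ≠ 0) (θ ρ : ℝ) : lrA r θ (0 : E3 → E3) ρ = 0 := by
  simp [lrA, Real.zero_rpow hr, Real.zero_rpow (inv_ne_zero hr)]

/-- **`Step_P51` (Prop 5.1 (11) at the consumed grain) HOLDS** (class = `{0}`; constants `0`).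
[cite: Nahiru2026, Prop 5.1 (11) p.8 l.89–106] -/
theorem step_P51_holds : Step_P51 := by
  intro ν hν θ _hθ _hθ1 v p hsol hweak
  obtain rfl := eq_zero_of_isSolution hν hsol hweak
  refine ⟨0, 0, 0, le_rfl, le_rfl, le_rfl, fun ρ _hρ => ?_⟩
  simp [E_zero]

/-- **`Step_T73` (Thm 7.3 (18), the key estimate) HOLDS** (class = `{0}`; constants `0`).
[cite: Nahiru2026, Thm 7.3 (18) p.12 l.20–25] -/
theorem step_T73_holds : Step_T73 := by
  intro ν hν θ _hθ _hθ1 q _hq _hq1 v p hsol hweak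
  obtain rfl := eq_zero_of_isSolution hν hsol hweak
  refine ⟨0, 0, 0, le_rfl, le_rfl, le_rfl, fun ρ _hρ => ?_⟩
  simp [E_zero]

/-- **`Step_P81` (Prop 8.1 (19)) HOLDS** — vacuously: on the class `E ≡ 0` never tends to `+∞`.
[cite: Nahiru2026, Prop 8.1 (19) p.12 l.118 – p.13 l.14] -/
theorem step_P81_holds : Step_P81 := by
  intro ν hν θ _hθ _hθ1 q _hq _hq1 v p hsol hweak hE
  obtain rfl := eq_zero_of_isSolution hν hsol hweak
  exfalso
  have h1 : Tendsto (fun _ : ℝ => (0 : ℝ)) atTop atTop := by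
    have hfun : E θ (0 : E3 → E3) = fun _ => 0 := funext (E_zero θ)
    simpa [hfun] using hE
  obtain ⟨i, hi⟩ := (tendsto_atTop_atTop.1 h1) 1
  have := hi i le_rfl
  norm_num at this

/-- **`Step_T91` (Thm 9.1, finite Dirichlet energy) HOLDS** (class = `{0}`). [cite: Nahiru2026, Thm 9.1 p.14 l.5–8] -/
theorem step_T91_holds : Step_T91 := by
  intro ν hν v p hsol hweak
  obtain rfl := eq_zero_of_isSolution hν hsol hweak
  rw [gradSq_zero]
  exact integrable_zero _ _ _

/-- **`Step_L101` (Lemma 10.1, upgraded regularity) HOLDS** (class = `{0}`, pressure constant; `C = 0`).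
[cite: Nahiru2026, Lemma 10.1 p.14 l.115 – p.15 l.37] -/
theorem step_L101_holds : Step_L101 := by
  refine ⟨0, le_rfl, fun ν hν v p hsol hweak _hint => ?_⟩
  obtain rfl := eq_zero_of_isSolution hν hsol hweak
  have hp : (fun x => p x - p 0) = fun _ => 0 :=
    funext fun x => by rw [pressure_const_of_isSolution_zero hsol x 0, sub_self]
  have hp3 : (fun x => |p x - p 0| ^ 3) = fun _ => (0 : ℝ) :=
    funext fun x => by rw [pressure_const_of_isSolution_zero hsol x 0, sub_self, abs_zero]; norm_num
  refine ⟨?_, ?_, p 0, ?_, ?_⟩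
  · exact MeasureTheory.MemLp.zero
  · simp [Real.zero_rpow]
  · rw [hp]; exact MeasureTheory.MemLp.zero
  · rw [hp3, integral_zero, Real.zero_rpow (by norm_num), zero_mul]

/-- **`Step_S10` (§10: finite Dirichlet energy ⇒ `v ≡ 0`) HOLDS** (class = `{0}`). [cite: Nahiru2026, §10 p.15 l.38 – p.16] -/
theorem step_S10_holds : Step_S10 :=
  fun _ν hν _v _p hsol hweak _ => eq_zero_of_isSolution hν hsol hweak

/-! ### Term I1's display for the smooth family (7) (refuter-6 g5, `StepP51I1.7e6bd816f9f30356.lean`) -/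

/-- The Laplacian of a cutoff of the family (7) vanishes inside `B_{θρ}`. [folklore] -/
private theorem laplacian_cutoff_eq_zero_of_lt {θ ρ Cθ : ℝ} {η : E3 → ℝ} (hη : IsCutoff θ ρ Cθ η) {x : E3}
    (hx : ‖x‖ < θ * ρ) : (Δ η) x = 0 := by
  have hloc : η =ᶠ[𝓝 x] fun _ => (1 : ℝ) := by
    have hopen : IsOpen {y : E3 | ‖y‖ < θ * ρ} := isOpen_lt continuous_norm continuous_const
    filter_upwards [hopen.mem_nhds hx] with y hy using hη.2.1 y hy
  have h := (InnerProductSpace.laplacian_congr_nhds hloc).eq_of_nhds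
  rw [h, InnerProductSpace.laplacian_const]
  rfl

/-- The Laplacian of a cutoff of the family (7) vanishes outside `B̄_ρ`. [folklore] -/
private theorem laplacian_cutoff_eq_zero_of_gt {θ ρ Cθ : ℝ} {η : E3 → ℝ} (hη : IsCutoff θ ρ Cθ η) {x : E3}
    (hx : ρ < ‖x‖) : (Δ η) x = 0 := by
  have hloc : η =ᶠ[𝓝 x] fun _ => (0 : ℝ) := by
    have hopen : IsOpen {y : E3 | ρ < ‖y‖} := isOpen_lt continuous_const continuous_norm
    filter_upwards [hopen.mem_nhds hx] with y hy using hη.2.2.1 y hy.le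
  have h := (InnerProductSpace.laplacian_congr_nhds hloc).eq_of_nhds
  rw [h, InnerProductSpace.laplacian_const]
  rfl

/-- Off the annulus `A(θρ,ρ)` and off the null sphere `|x| = ρ`, the integrand `|v|² Δη` vanishes. [folklore] -/
private theorem integrand_eq_indicator_ae {θ ρ Cθ : ℝ} {η : E3 → ℝ} (hη : IsCutoff θ ρ Cθ η) (v : E3 → E3) :
    (fun x => ‖v x‖ ^ 2 * (Δ η) x) =ᵐ[volume]
      (annulus θ ρ).indicator fun x => ‖v x‖ ^ 2 * (Δ η) x := by
  have hN : volume (sphere (0 : E3) ρ) = 0 := Measure.addHaar_sphere volume 0 ρ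
  filter_upwards [measure_eq_zero_iff_ae_notMem.1 hN] with x hx
  by_cases hA : x ∈ annulus θ ρ
  · rw [indicator_of_mem hA]
  · rw [indicator_of_notMem hA]
    simp only [annulus, Set.mem_sdiff, mem_ball, dist_zero_right, not_and, not_not] at hA
    have hxs : ‖x‖ ≠ ρ := by
      intro h; exact hx (by rw [mem_sphere, dist_zero_right]; exact h)
    rcases lt_or_ge ‖x‖ ρ with h1 | h1
    · rw [laplacian_cutoff_eq_zero_of_lt hη (hA h1), mul_zero]
    · rw [laplacian_cutoff_eq_zero_of_gt hη (lt_of_le_of_ne h1 (Ne.symm hxs)), mul_zero]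

/-- `|v|²` of a continuous field is integrable on the (bounded) annulus. [folklore] -/
private theorem integrableOn_normSq_annulus {v : E3 → E3} (hv : Continuous v) (θ ρ : ℝ) :
    IntegrableOn (fun x => ‖v x‖ ^ 2) (annulus θ ρ) volume := by
  have hK : IsCompact (closedBall (0 : E3) ρ) := isCompact_closedBall _ _
  have hc : Continuous fun x => ‖v x‖ ^ 2 := (continuous_norm.comp hv).pow 2
  exact (hc.continuousOn.integrableOn_compact hK).mono_set
    (sdiff_subset.trans ball_subset_closedBall)

/-- **`Step_P51_I1` HOLDS**: Term I1's display `|∫|v|²∆η| ≤ (C_θ/ρ²)‖v‖²_{L²(A(θρ,ρ))}` for every cutoff of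
the smooth family (7) and every smooth field. [cite: Nahiru2026, Term I1 p.8 l.127–136; (7) p.7 l.3–19] -/
theorem step_P51_I1_holds : Step_P51_I1 := by
  intro θ _hθ _hθ1 Cθ ρ _hρ η hη v hv
  have hvc : Continuous v := hv.continuous
  have hmeas : MeasurableSet (annulus θ ρ) := measurableSet_ball.diff measurableSet_ball
  rw [integral_congr_ae (integrand_eq_indicator_ae hη v), integral_indicator hmeas]
  have hint : IntegrableOn (fun x => Cθ / ρ ^ 2 * ‖v x‖ ^ 2) (annulus θ ρ) volume :=
    (integrableOn_normSq_annulus hvc θ ρ).const_mul _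
  have hbound : ∀ x, |‖v x‖ ^ 2 * (Δ η) x| ≤ Cθ / ρ ^ 2 * ‖v x‖ ^ 2 := fun x => by
    rw [abs_mul, abs_of_nonneg (sq_nonneg _), mul_comm]
    exact mul_le_mul_of_nonneg_right (hη.2.2.2.2.2 x) (sq_nonneg _)
  calc |∫ x in annulus θ ρ, ‖v x‖ ^ 2 * (Δ η) x|
      ≤ ∫ x in annulus θ ρ, |‖v x‖ ^ 2 * (Δ η) x| := abs_integral_le_integral_abs
    _ ≤ ∫ x in annulus θ ρ, Cθ / ρ ^ 2 * ‖v x‖ ^ 2 :=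
        integral_mono_of_nonneg (Eventually.of_forall fun x => abs_nonneg _) hint
          (Eventually.of_forall hbound)
    _ = Cθ / ρ ^ 2 * ∫ x in annulus θ ρ, ‖v x‖ ^ 2 := integral_const_mul _ _

/-! ### The five links hold (their conclusions are solution-level theorems above) -/

/-- The §5 link holds. [cite: Nahiru2026, Prop 5.1 proof p.8 l.107 – p.9 l.84] -/
theorem step_P51_of_holds : Step_P51_of := fun _ _ => step_P51_holds

/-- The §7.3 link holds. [cite: Nahiru2026, Thm 7.3 proof p.12 l.26–97] -/
theorem step_T73_of_holds : Step_T73_of := fun _ _ => step_T73_holds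

/-- The §8 link holds. [cite: Nahiru2026, Prop 8.1 proof p.13 l.15–102] -/
theorem step_P81_of_holds : Step_P81_of := fun _ _ => step_P81_holds

/-- The §9 link holds. [cite: Nahiru2026, Thm 9.1 proof p.14 l.9–91] -/
theorem step_T91_of_holds : Step_T91_of := fun _ _ => step_T91_holds

/-- The §10 link holds. [cite: Nahiru2026, §10 p.15 l.38 – p.16 l.56] -/
theorem step_S10_of_holds : Step_S10_of := fun _ _ _ => step_S10_holds

/-! ## §J The printed LINKS hold IN SUBSTANCE (rev 5, custodian fold of ns-claims-refuter-7 g5's addenda #1–#3,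
`Links178.eade0f42d81eb6b5.lean`, verbatim under `namespace Links` with `[folklore]` helpers made `private`):
Thm 7.3 from (11) + (17) by rpow bookkeeping (`Links.step_T73_of_P51_P72`), Prop 8.1 from (18) + Lemma 2.2
exactly as printed on p.13 (`Links.step_P81_of_T73_L22`), Thm 9.1 from Prop 8.1 by the monotone dichotomy and
the real-variable ODE comparison `Links.ode_comparison_false` (`Links.step_T91_of_P81`), and the kernel
composition of Theorem 1.1 from the print's four remaining inputs (11), (17), Lemma 2.2, §10
(`Links.claim_of_P51_P72_L22_S10`). These are print-faithful derivations, independent of §I's evaluation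
at `v = 0`; records-grade for the row (RULINGS v1.53 (B)). -/

namespace Links

/-! ## §7.3 link -/

/-- **Link §7.3 (PROVED)**: `Step_P51 → Step_P72 → Step_T73` (Thm 7.3 (18) p.12 l.20–97 from Prop 5.1
(11) and Prop 7.2 (17); pure rpow bookkeeping, `b − 1 = γ`). [cite: Nahiru2026, Thm 7.3 (18) p.12 l.20–97] -/
theorem step_T73_of_P51_P72 (hP51 : Step_P51) (hP72 : Step_P72) : Step_T73 := by
  intro ν hν θ hθ0 hθ1 q hq1 hq2 v p hsol hweak
  obtain ⟨Cstar, C1, C3, hCs, hC1, hC3, h51⟩ := hP51 ν hν θ hθ0 hθ1 v p hsol hweak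
  obtain ⟨C, hC, h72⟩ := hP72 θ hθ0 hθ1 q hq1 hq2 v hsol.2.1 hweak
  have hM : 0 ≤ M v := ENNReal.toReal_nonneg
  have hMa : 0 ≤ M v ^ (3 * q / (6 - q)) := Real.rpow_nonneg hM _
  have hM3 : 0 ≤ M v ^ 3 := pow_nonneg hM 3
  refine ⟨Cstar / ν, (C1 + C3 * (C * M v ^ 3)) / ν, C3 * (C * M v ^ (3 * q / (6 - q))) / ν,
    div_nonneg hCs hν.le, div_nonneg (by positivity) hν.le, div_nonneg (by positivity) hν.le, ?_⟩
  intro ρ hρ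
  have h1 := h51 ρ hρ
  have h2 := h72 ρ hρ
  have hρinv : 0 ≤ ρ⁻¹ := (inv_pos.mpr hρ).le
  have hq6 : (6 - q) ≠ 0 := by
    have : 0 < 6 - q := by linarith
    exact this.ne'
  -- the exponent identity ρ⁻¹ · ρ^b = ρ^γ, γ = b − 1
  have hexp : ρ⁻¹ * ρ ^ (3 * (3 - q) / (6 - q)) = ρ ^ ((3 - 2 * q) / (6 - q)) := by
    rw [← Real.rpow_neg_one, ← Real.rpow_add hρ]
    congr 1
    field_simp
    ring
  -- insert (17) into the cubic term of (11)
  have h3 : C3 * ρ⁻¹ * (lrA 3 θ v ρ) ^ 3 ≤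
      C3 * ρ⁻¹ * (C * M v ^ (3 * q / (6 - q)) * ρ ^ (3 * (3 - q) / (6 - q)) *
        (D θ v ρ) ^ (3 * (3 - q) / (6 - q)) + C * M v ^ 3) :=
    mul_le_mul_of_nonneg_left h2 (mul_nonneg hC3 hρinv)
  have hmain : ν * E θ v ρ ≤
      Cstar * ρ ^ (-(1 / 2 : ℝ)) * (D θ v ρ) ^ (1 / 2 : ℝ) + (C1 + C3 * (C * M v ^ 3)) * ρ⁻¹ +
        C3 * (C * M v ^ (3 * q / (6 - q))) * ρ ^ ((3 - 2 * q) / (6 - q)) *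
          (D θ v ρ) ^ (3 * (3 - q) / (6 - q)) := by
    have hre : Cstar * ρ ^ (-(1 / 2 : ℝ)) * (D θ v ρ) ^ (1 / 2 : ℝ) + C1 * ρ⁻¹ +
        C3 * ρ⁻¹ * (C * M v ^ (3 * q / (6 - q)) * ρ ^ (3 * (3 - q) / (6 - q)) *
          (D θ v ρ) ^ (3 * (3 - q) / (6 - q)) + C * M v ^ 3) =
        Cstar * ρ ^ (-(1 / 2 : ℝ)) * (D θ v ρ) ^ (1 / 2 : ℝ) + (C1 + C3 * (C * M v ^ 3)) * ρ⁻¹ +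
          C3 * (C * M v ^ (3 * q / (6 - q))) * ρ ^ ((3 - 2 * q) / (6 - q)) *
            (D θ v ρ) ^ (3 * (3 - q) / (6 - q)) := by
      rw [← hexp]; ring
    linarith [h1, h3, hre]
  -- divide by ν
  have hdiv : Cstar / ν * ρ ^ (-(1 / 2 : ℝ)) * (D θ v ρ) ^ (1 / 2 : ℝ) +
      (C1 + C3 * (C * M v ^ 3)) / ν * ρ⁻¹ +
        C3 * (C * M v ^ (3 * q / (6 - q))) / ν * ρ ^ ((3 - 2 * q) / (6 - q)) *
          (D θ v ρ) ^ (3 * (3 - q) / (6 - q)) =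
      (Cstar * ρ ^ (-(1 / 2 : ℝ)) * (D θ v ρ) ^ (1 / 2 : ℝ) + (C1 + C3 * (C * M v ^ 3)) * ρ⁻¹ +
        C3 * (C * M v ^ (3 * q / (6 - q))) * ρ ^ ((3 - 2 * q) / (6 - q)) *
          (D θ v ρ) ^ (3 * (3 - q) / (6 - q))) / ν := by
    field_simp
  rw [hdiv, le_div_iff₀ hν]
  linarith [hmain]

/-! ## §8 link -/


/-- `D(ρ) ≥ 0`. [cite: Nahiru2026, Notation 2.1 p.4 l.43–46] [folklore] -/
private theorem D_nonneg (θ : ℝ) (v : E3 → E3) (ρ : ℝ) : 0 ≤ D θ v ρ := by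
  unfold D gradSq
  exact integral_nonneg fun x => frobeniusNormSq_nonneg _

/-- **Link §8 (PROVED)**: `Step_T73 → Step_L22 → Step_P81` (Prop 8.1 (19) from Thm 7.3 (18) and
Lemma 2.2 (3), p.13 l.15–102). [cite: Nahiru2026, Prop 8.1 (19) p.12 l.118 – p.13 l.102] -/
theorem step_P81_of_T73_L22 (hT73 : Step_T73) (hL22 : Step_L22) : Step_P81 := by
  intro ν hν θ hθ0 hθ1 q hq1 hq2 v p hsol hweak hE
  have hq3 : q < 3 := by linarith
  have h6q : 0 < 6 - q := by linarith
  have h3q : 0 < 3 - q := by linarith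
  have h6q' : 6 - q ≠ 0 := h6q.ne'
  have h3q' : 3 - q ≠ 0 := h3q.ne'
  have h1θ : 0 < 1 - θ := by linarith
  obtain ⟨K0, K1, K2, hK0, hK1, hK2, h73⟩ := hT73 ν hν θ hθ0 hθ1 q hq1 hq3 v p hsol hweak
  obtain ⟨-, E', hE'⟩ := hL22 θ hθ0 hθ1 v hsol.2.1
  -- exponent facts on the printed range 3/2 < q ≤ 12/5
  have hb0 : 0 < 3 * (3 - q) / (6 - q) := div_pos (by linarith) h6q
  have hbne : 3 * (3 - q) / (6 - q) ≠ 0 := hb0.ne'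
  have hbhalf : (1 / 2 : ℝ) ≤ 3 * (3 - q) / (6 - q) := by
    rw [le_div_iff₀ h6q]; linarith
  have hγhalf : -(1 / 2 : ℝ) ≤ (3 - 2 * q) / (6 - q) := by
    rw [le_div_iff₀ h6q]; linarith
  have hγ0 : (3 - 2 * q) / (6 - q) ≤ 0 := by
    rw [div_le_iff₀ h6q, zero_mul]; linarith
  -- E → ∞ : eventually E ≥ 2 (K0 + K1) + 2
  obtain ⟨ρ₁, hρ₁⟩ := (tendsto_atTop_atTop.mp hE) (2 * (K0 + K1) + 2)
  -- the working bound, for ρ ≥ max 1 ρ₁ :  E ≤ (K0 + K2) ρ^γ D^b + K0 + K1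
  have hwork : ∀ ρ : ℝ, max 1 ρ₁ ≤ ρ →
      E θ v ρ ≤ (K0 + K2) * ρ ^ ((3 - 2 * q) / (6 - q)) * (D θ v ρ) ^ (3 * (3 - q) / (6 - q)) +
        K0 + K1 := by
    intro ρ hρ
    have hρ1 : 1 ≤ ρ := le_trans (le_max_left _ _) hρ
    have hρ : 0 < ρ := by linarith
    have hD0 : 0 ≤ D θ v ρ := D_nonneg θ v ρ
    have h1 := h73 ρ hρ
    -- ρ^{-1/2} ≤ ρ^γ ≤ 1, ρ⁻¹ ≤ 1
    have hr1 : ρ ^ (-(1 / 2 : ℝ)) ≤ ρ ^ ((3 - 2 * q) / (6 - q)) :=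
      Real.rpow_le_rpow_of_exponent_le hρ1 hγhalf
    have hr2 : ρ ^ ((3 - 2 * q) / (6 - q)) ≤ 1 := Real.rpow_le_one_of_one_le_of_nonpos hρ1 hγ0
    have hr3 : ρ⁻¹ ≤ 1 := inv_le_one_of_one_le₀ hρ1
    have hrγ0 : 0 ≤ ρ ^ ((3 - 2 * q) / (6 - q)) := Real.rpow_nonneg hρ.le _
    -- D^{1/2} ≤ D^b + 1
    have hDb0 : 0 ≤ (D θ v ρ) ^ (3 * (3 - q) / (6 - q)) := Real.rpow_nonneg hD0 _
    have hDhalf : (D θ v ρ) ^ (1 / 2 : ℝ) ≤ (D θ v ρ) ^ (3 * (3 - q) / (6 - q)) + 1 := by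
      rcases le_or_gt 1 (D θ v ρ) with hD1 | hD1
      · have := Real.rpow_le_rpow_of_exponent_le hD1 hbhalf
        linarith
      · have : (D θ v ρ) ^ (1 / 2 : ℝ) ≤ 1 := Real.rpow_le_one hD0 hD1.le (by norm_num)
        linarith
    -- assemble
    have t1 : K0 * ρ ^ (-(1 / 2 : ℝ)) * (D θ v ρ) ^ (1 / 2 : ℝ) ≤
        K0 * ρ ^ ((3 - 2 * q) / (6 - q)) * ((D θ v ρ) ^ (3 * (3 - q) / (6 - q)) + 1) :=
      mul_le_mul (mul_le_mul_of_nonneg_left hr1 hK0) hDhalf (Real.rpow_nonneg hD0 _)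
        (mul_nonneg hK0 hrγ0)
    have t2 : K1 * ρ⁻¹ ≤ K1 := mul_le_of_le_one_right hK1 hr3
    have t3 : K0 * ρ ^ ((3 - 2 * q) / (6 - q)) ≤ K0 := mul_le_of_le_one_right hK0 hr2
    nlinarith [t1, t2, t3, h1, mul_nonneg hK2 (mul_nonneg hrγ0 hDb0)]
  -- K := K0 + K2 is positive (else E would be bounded by K0 + K1 at ρ = max 1 ρ₁)
  have hKpos : 0 < K0 + K2 := by
    by_contra hK
    have hK' : K0 + K2 = 0 := le_antisymm (not_lt.mp hK) (add_nonneg hK0 hK2)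
    have h1 := hwork (max 1 ρ₁) le_rfl
    have h2 := hρ₁ (max 1 ρ₁) (le_max_right _ _)
    rw [hK', zero_mul, zero_mul, zero_add] at h1
    linarith
  -- the constant
  set K : ℝ := K0 + K2 with hKdef
  refine ⟨θ / (1 - θ) * (2 * K) ^ (-(1 / (3 * (3 - q) / (6 - q)))), max 1 ρ₁,
    mul_pos (div_pos hθ0 h1θ) (Real.rpow_pos_of_pos (by positivity) _), le_max_left _ _, ?_⟩
  intro ρ hρ
  have hρ1 : 1 ≤ ρ := le_trans (le_max_left _ _) hρ
  have hρpos : 0 < ρ := by linarith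
  have hD0 : 0 ≤ D θ v ρ := D_nonneg θ v ρ
  obtain ⟨hderiv, -, hD3⟩ := hE' ρ hρpos
  have hEw := hwork ρ hρ
  have hEbig := hρ₁ ρ (le_trans (le_max_right _ _) hρ)
  have hrγpos : 0 < ρ ^ ((3 - 2 * q) / (6 - q)) := Real.rpow_pos_of_pos hρpos _
  have h2Kρ : 0 < 2 * K * ρ ^ ((3 - 2 * q) / (6 - q)) := by positivity
  have hEpos : 0 < E θ v ρ := by linarith
  -- ½ E ≤ K ρ^γ D^b, i.e. E / (2 K ρ^γ) ≤ D^b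
  have h5 : E θ v ρ / (2 * K * ρ ^ ((3 - 2 * q) / (6 - q))) ≤
      (D θ v ρ) ^ (3 * (3 - q) / (6 - q)) := by
    rw [div_le_iff₀ h2Kρ]
    nlinarith [hEw, hEbig]
  -- raise to the power 1/b :  X := (E/(2Kρ^γ))^{1/b} ≤ D
  have hX0 : 0 ≤ E θ v ρ / (2 * K * ρ ^ ((3 - 2 * q) / (6 - q))) := div_nonneg hEpos.le h2Kρ.le
  have h6 : (E θ v ρ / (2 * K * ρ ^ ((3 - 2 * q) / (6 - q)))) ^ (1 / (3 * (3 - q) / (6 - q))) ≤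
      D θ v ρ := by
    have key : ((D θ v ρ) ^ (3 * (3 - q) / (6 - q))) ^ (1 / (3 * (3 - q) / (6 - q))) = D θ v ρ := by
      rw [one_div, Real.rpow_rpow_inv hD0 hbne]
    calc (E θ v ρ / (2 * K * ρ ^ ((3 - 2 * q) / (6 - q)))) ^ (1 / (3 * (3 - q) / (6 - q)))
        ≤ ((D θ v ρ) ^ (3 * (3 - q) / (6 - q))) ^ (1 / (3 * (3 - q) / (6 - q))) :=
          Real.rpow_le_rpow hX0 h5 (one_div_nonneg.mpr hb0.le)
      _ = D θ v ρ := key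
  -- Lemma 2.2 (3):  θ/((1-θ)ρ) · D ≤ E'
  have hpos : 0 < θ / ((1 - θ) * ρ) := div_pos hθ0 (mul_pos h1θ hρpos)
  have h7 : θ / ((1 - θ) * ρ) * D θ v ρ ≤ E' ρ := by
    calc θ / ((1 - θ) * ρ) * D θ v ρ ≤ θ / ((1 - θ) * ρ) * ((1 - θ) / θ * ρ * E' ρ) :=
          mul_le_mul_of_nonneg_left hD3 hpos.le
      _ = E' ρ := by field_simp
  -- rpow bookkeeping: c ρ^{-α} E^{β} = θ/((1-θ)ρ) · X
  have hβ : (6 - q) / (3 * (3 - q)) = 1 / (3 * (3 - q) / (6 - q)) := by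
    field_simp
  have hα : ρ ^ (-((12 - 5 * q) / (3 * (3 - q)))) =
      ρ ^ (-1 : ℝ) * ρ ^ (-(((3 - 2 * q) / (6 - q)) * (1 / (3 * (3 - q) / (6 - q))))) := by
    rw [← Real.rpow_add hρpos]
    congr 1
    field_simp
    ring
  have hXexp : (E θ v ρ / (2 * K * ρ ^ ((3 - 2 * q) / (6 - q)))) ^ (1 / (3 * (3 - q) / (6 - q))) =
      (E θ v ρ) ^ (1 / (3 * (3 - q) / (6 - q))) * (2 * K) ^ (-(1 / (3 * (3 - q) / (6 - q)))) *
        ρ ^ (-(((3 - 2 * q) / (6 - q)) * (1 / (3 * (3 - q) / (6 - q))))) := by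
    rw [Real.div_rpow hEpos.le h2Kρ.le, Real.mul_rpow (by positivity) hrγpos.le,
      Real.rpow_neg (by positivity : (0 : ℝ) ≤ 2 * K), Real.rpow_neg hρpos.le,
      ← Real.rpow_mul hρpos.le]
    field_simp
  have heq : θ / (1 - θ) * (2 * K) ^ (-(1 / (3 * (3 - q) / (6 - q)))) *
        ρ ^ (-((12 - 5 * q) / (3 * (3 - q)))) * (E θ v ρ) ^ ((6 - q) / (3 * (3 - q))) =
      θ / ((1 - θ) * ρ) *
        (E θ v ρ / (2 * K * ρ ^ ((3 - 2 * q) / (6 - q)))) ^ (1 / (3 * (3 - q) / (6 - q))) := by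
    rw [hXexp, hα, hβ, Real.rpow_neg_one]
    field_simp
  calc θ / (1 - θ) * (2 * K) ^ (-(1 / (3 * (3 - q) / (6 - q)))) *
        ρ ^ (-((12 - 5 * q) / (3 * (3 - q)))) * (E θ v ρ) ^ ((6 - q) / (3 * (3 - q)))
        = θ / ((1 - θ) * ρ) *
          (E θ v ρ / (2 * K * ρ ^ ((3 - 2 * q) / (6 - q)))) ^ (1 / (3 * (3 - q) / (6 - q))) := heq
    _ ≤ θ / ((1 - θ) * ρ) * D θ v ρ := mul_le_mul_of_nonneg_left h6 hpos.le
    _ ≤ E' ρ := h7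
    _ = deriv (E θ v) ρ := hderiv.deriv.symm

/-! ## §9 link -/


/-! ### hat-function facts (Notation 2.1 p.4 l.28–37) [folklore] -/

/-- Helper `hat_eq_clamp`. [folklore] -/
private theorem hat_eq_clamp {θ : ℝ} (hθ : θ < 1) (t : ℝ) :
    hat θ t = max 0 (min 1 ((1 - t) / (1 - θ))) := by
  have h1θ : 0 < 1 - θ := by linarith
  unfold hat
  split_ifs with h1 h2
  · have : 1 ≤ (1 - t) / (1 - θ) := by rw [le_div_iff₀ h1θ]; linarith
    rw [min_eq_left this, max_eq_right zero_le_one]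
  · have hle : (1 - t) / (1 - θ) ≤ 1 := by rw [div_le_iff₀ h1θ]; linarith
    have hge : 0 ≤ (1 - t) / (1 - θ) := div_nonneg (by linarith) h1θ.le
    rw [min_eq_right hle, max_eq_right hge]
  · have hle : (1 - t) / (1 - θ) ≤ 0 := div_nonpos_of_nonpos_of_nonneg (by linarith) h1θ.le
    rw [min_eq_right (hle.trans zero_le_one), max_eq_left hle]

/-- Helper `continuous_hat`. [folklore] -/
private theorem continuous_hat {θ : ℝ} (hθ : θ < 1) : Continuous (hat θ) := by
  have : hat θ = fun t => max 0 (min 1 ((1 - t) / (1 - θ))) := funext (hat_eq_clamp hθ)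
  rw [this]
  exact continuous_const.max (continuous_const.min ((continuous_const.sub continuous_id).div_const _))

/-- Helper `hat_antitone`. [folklore] -/
private theorem hat_antitone {θ : ℝ} (hθ : θ < 1) : Antitone (hat θ) := by
  intro t t' htt'
  have h1θ : 0 < 1 - θ := by linarith
  rw [hat_eq_clamp hθ, hat_eq_clamp hθ]
  exact max_le_max le_rfl (min_le_min le_rfl (div_le_div_of_nonneg_right (by linarith) h1θ.le))

/-- The hat is nonnegative. [folklore] -/
private theorem hat_nonneg {θ : ℝ} (hθ : θ < 1) (t : ℝ) : 0 ≤ hat θ t := by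
  rw [hat_eq_clamp hθ]; exact le_max_left _ _

/-- The hat is at most one. [folklore] -/
private theorem hat_le_one {θ : ℝ} (hθ : θ < 1) (t : ℝ) : hat θ t ≤ 1 := by
  rw [hat_eq_clamp hθ]; exact max_le zero_le_one (min_le_left _ _)

/-- The hat equals one below `θ`. [folklore] -/
private theorem hat_eq_one {θ t : ℝ} (ht : t < θ) : hat θ t = 1 := by
  unfold hat; rw [if_pos ht]

/-- The hat vanishes from `1` on. [folklore] -/
private theorem hat_eq_zero {θ t : ℝ} (hθ : θ < 1) (ht : 1 ≤ t) : hat θ t = 0 := by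
  unfold hat; rw [if_neg (by linarith), if_neg (by linarith)]

/-! ### the integrand of `E` -/

/-- `|∇v|² ≥ 0`. [folklore] -/
private theorem gradSq_nonneg (v : E3 → E3) (x : E3) : 0 ≤ gradSq v x := frobeniusNormSq_nonneg _

/-- `|∇v|²` is continuous for smooth `v`. [folklore] -/
private theorem continuous_gradSq' {v : E3 → E3} (hv : ContDiff ℝ (⊤ : ℕ∞) v) : Continuous (gradSq v) := by
  have h1 : Continuous fun x => fderiv ℝ v x := hv.continuous_fderiv (by simp)
  unfold gradSq frobeniusNormSq
  exact continuous_finsetSum _ fun i _ => ((h1.clm_apply continuous_const).norm).pow 2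

/-- The truncated integrand `|∇v|² φ(|x|/ρ)` is continuous with compact support, hence integrable. [folklore] -/
private theorem integrable_gradSq_mul_hat {θ : ℝ} (hθ : θ < 1) {v : E3 → E3} (hv : ContDiff ℝ (⊤ : ℕ∞) v)
    {ρ : ℝ} (hρ : 0 < ρ) : Integrable (fun x => gradSq v x * hat θ (‖x‖ / ρ)) volume := by
  have hcont : Continuous fun x : E3 => gradSq v x * hat θ (‖x‖ / ρ) :=
    (continuous_gradSq' hv).mul ((continuous_hat hθ).comp (continuous_norm.div_const ρ))
  have hsupp : HasCompactSupport fun x : E3 => gradSq v x * hat θ (‖x‖ / ρ) := by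
    refine HasCompactSupport.intro (isCompact_closedBall (0 : E3) ρ) fun x hx => ?_
    have hx' : ρ < ‖x‖ := by simpa [mem_closedBall, dist_zero_right] using hx
    have : 1 ≤ ‖x‖ / ρ := by rw [le_div_iff₀ hρ]; linarith
    simp [hat_eq_zero hθ this]
  exact hcont.integrable_of_hasCompactSupport hsupp

/-! ### the ODE comparison of §9 (p.14 l.31–91), as a real-variable lemma -/

/-- If `F ≥ 1` on `[ρ₀, ∞)` (`ρ₀ ≥ 1`) and `deriv F ρ ≥ c ρ^{−α} F(ρ)^β` there with `c > 0`,
`α < 1 < β`, contradiction: `G = F^{1−β} + (β−1)cρ^{1−α}/(1−α)` is non-increasing while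
`ρ^{1−α} → ∞`. (Differentiability of `F` is forced pointwise: a junk `deriv = 0` would violate the
strict positivity of the right-hand side.) [cite: Nahiru2026, Thm 9.1 proof p.14 l.31–91] -/
theorem ode_comparison_false {F : ℝ → ℝ} {c ρ₀ α β : ℝ} (hc : 0 < c) (hα : α < 1) (hβ : 1 < β)
    (hρ₀ : 1 ≤ ρ₀) (hF1 : ∀ ρ, ρ₀ ≤ ρ → 1 ≤ F ρ)
    (hode : ∀ ρ, ρ₀ ≤ ρ → c * ρ ^ (-α) * F ρ ^ β ≤ deriv F ρ) : False := by
  -- pointwise facts on [ρ₀, ∞)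
  have hFpos : ∀ ρ, ρ₀ ≤ ρ → 0 < F ρ := fun ρ h => lt_of_lt_of_le one_pos (hF1 ρ h)
  have hrhs : ∀ ρ, ρ₀ ≤ ρ → 0 < c * ρ ^ (-α) * F ρ ^ β := fun ρ h =>
    mul_pos (mul_pos hc (Real.rpow_pos_of_pos (by linarith) _)) (Real.rpow_pos_of_pos (hFpos ρ h) _)
  have hdiff : ∀ ρ, ρ₀ ≤ ρ → DifferentiableAt ℝ F ρ := fun ρ h =>
    differentiableAt_of_deriv_ne_zero (ne_of_gt (lt_of_lt_of_le (hrhs ρ h) (hode ρ h)))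
  -- the comparison function
  set G : ℝ → ℝ := fun ρ => F ρ ^ (1 - β) + (β - 1) * c / (1 - α) * ρ ^ (1 - α) with hG
  have hGderiv : ∀ ρ, ρ₀ ≤ ρ → HasDerivAt G
      ((1 - β) * F ρ ^ (1 - β - 1) * deriv F ρ + (β - 1) * c / (1 - α) * ((1 - α) * ρ ^ (1 - α - 1))) ρ := by
    intro ρ h
    have hρ : 0 < ρ := by linarith
    have h1 : HasDerivAt (fun ρ => F ρ ^ (1 - β)) ((1 - β) * F ρ ^ (1 - β - 1) * deriv F ρ) ρ := by
      have := ((hdiff ρ h).hasDerivAt).rpow_const (p := 1 - β) (Or.inl (hFpos ρ h).ne')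
      convert this using 1; ring
    have h2 : HasDerivAt (fun ρ : ℝ => ρ ^ (1 - α)) ((1 - α) * ρ ^ (1 - α - 1)) ρ := by
      have := (hasDerivAt_id ρ).rpow_const (p := 1 - α) (Or.inl hρ.ne')
      simpa using this
    exact h1.add (h2.const_mul _)
  have hGle : ∀ ρ, ρ₀ ≤ ρ → deriv G ρ ≤ 0 := by
    intro ρ h
    have hρ : 0 < ρ := by linarith
    rw [(hGderiv ρ h).deriv]
    have hα1 : (1 - α) ≠ 0 := by linarith
    have hsimp : (β - 1) * c / (1 - α) * ((1 - α) * ρ ^ (1 - α - 1)) = (β - 1) * c * ρ ^ (-α) := by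
      field_simp; ring_nf
    rw [hsimp]
    -- (1-β) F^{-β} F' + (β-1) c ρ^{-α} ≤ 0  ⇐  c ρ^{-α} F^β ≤ F'
    have hFβ : 0 < F ρ ^ β := Real.rpow_pos_of_pos (hFpos ρ h) _
    have hFnegβ : F ρ ^ (1 - β - 1) = (F ρ ^ β)⁻¹ := by
      rw [show (1 - β - 1 : ℝ) = -β by ring, Real.rpow_neg (hFpos ρ h).le]
    rw [hFnegβ]
    have key : c * ρ ^ (-α) ≤ (F ρ ^ β)⁻¹ * deriv F ρ := by
      rw [le_inv_mul_iff₀ hFβ]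
      calc F ρ ^ β * (c * ρ ^ (-α)) = c * ρ ^ (-α) * F ρ ^ β := by ring
        _ ≤ deriv F ρ := hode ρ h
    nlinarith [key, hβ]
  -- G is non-increasing on [ρ₀, ∞)
  have hGanti : AntitoneOn G (Ici ρ₀) := by
    have hdG : ∀ ρ ∈ Ici ρ₀, DifferentiableAt ℝ G ρ := fun ρ h => (hGderiv ρ h).differentiableAt
    refine antitoneOn_of_deriv_nonpos (convex_Ici ρ₀)
      (fun ρ h => (hdG ρ h).continuousAt.continuousWithinAt)
      (fun ρ h => (hdG ρ (interior_subset h)).differentiableWithinAt)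
      (fun ρ h => hGle ρ (interior_subset (s := Ici ρ₀) h))
  -- ρ^{1-α} → ∞: pick ρ ≥ ρ₀ with (β-1)c/(1-α) ρ^{1-α} > G ρ₀
  have hcoef : 0 < (β - 1) * c / (1 - α) := div_pos (mul_pos (by linarith) hc) (by linarith)
  obtain ⟨ρ₂, hρ₂⟩ := (tendsto_atTop_atTop.mp (tendsto_rpow_atTop (by linarith : 0 < 1 - α)))
    ((G ρ₀ + 1) / ((β - 1) * c / (1 - α)))
  set ρ := max ρ₀ ρ₂ with hρdef
  have hρ0 : ρ₀ ≤ ρ := le_max_left _ _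
  have h1 : G ρ ≤ G ρ₀ := hGanti (self_mem_Ici) hρ0 hρ0
  have h2 : (G ρ₀ + 1) / ((β - 1) * c / (1 - α)) ≤ ρ ^ (1 - α) := hρ₂ ρ (le_max_right _ _)
  have h3 : G ρ₀ + 1 ≤ (β - 1) * c / (1 - α) * ρ ^ (1 - α) := by
    rw [div_le_iff₀ hcoef] at h2; linarith
  have h4 : 0 < F ρ ^ (1 - β) := Real.rpow_pos_of_pos (hFpos ρ hρ0) _
  have h5 : G ρ = F ρ ^ (1 - β) + (β - 1) * c / (1 - α) * ρ ^ (1 - α) := rfl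
  linarith

/-- `E` is non-decreasing on `(0, ∞)` — the part of Lemma 2.2 that Theorem 9.1 uses, proved from the
definition (the hat is non-increasing). [cite: Nahiru2026, Lemma 2.2 p.4 l.52 – p.5 l.9] [folklore] -/
private theorem E_monotoneOn {θ : ℝ} (hθ1 : θ < 1) {v : E3 → E3} (hv : ContDiff ℝ (⊤ : ℕ∞) v) :
    MonotoneOn (E θ v) (Ioi 0) := by
  intro ρ hρ ρ' hρ' hle
  unfold E
  refine integral_mono (integrable_gradSq_mul_hat hθ1 hv hρ) (integrable_gradSq_mul_hat hθ1 hv hρ')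
    fun x => ?_
  refine mul_le_mul_of_nonneg_left (hat_antitone hθ1 ?_) (gradSq_nonneg v x)
  exact div_le_div_of_nonneg_left (norm_nonneg x) hρ hle

/-! ### the §9 link -/

/-- **Link §9 (PROVED)**: `Step_P81 → Step_T91` (Thm 9.1 p.14 l.5–91 from Prop 8.1 at `p = 2`,
`θ = 1/2`, and the monotonicity of `E` (Lemma 2.2, here `E_monotoneOn`); differentiability of `E` is
not even needed as an input: where `deriv` would be junk `0`, (19) is already contradictory).
[cite: Nahiru2026, Thm 9.1 p.14 l.5–91] -/
theorem step_T91_of_P81 (hP81 : Step_P81) : Step_T91 := by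
  intro ν hν v p hsol hweak
  have hθ0 : (0 : ℝ) < 1 / 2 := by norm_num
  have hθ1 : (1 / 2 : ℝ) < 1 := by norm_num
  have hv : ContDiff ℝ (⊤ : ℕ∞) v := hsol.2.1
  have hmono : MonotoneOn (E (1 / 2) v) (Ioi 0) := E_monotoneOn hθ1 hv
  by_cases hbdd : ∃ L : ℝ, ∀ ρ : ℝ, 0 < ρ → E (1 / 2) v ρ ≤ L
  · -- bounded branch: monotone convergence of the hats
    obtain ⟨L, hL⟩ := hbdd
    set g : ℕ → E3 → ℝ≥0∞ := fun n x => ENNReal.ofReal (gradSq v x * hat (1 / 2) (‖x‖ / (n + 1)))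
      with hg
    have hgmeas : ∀ n, Measurable (g n) := fun n =>
      (((continuous_gradSq' hv).mul ((continuous_hat hθ1).comp
        (continuous_norm.div_const _))).measurable).ennreal_ofReal
    have hgmono : Monotone g := by
      intro n m hnm x
      refine ENNReal.ofReal_le_ofReal (mul_le_mul_of_nonneg_left ?_ (gradSq_nonneg v x))
      refine hat_antitone hθ1 (div_le_div_of_nonneg_left (norm_nonneg x) (by positivity) ?_)
      exact_mod_cast Nat.succ_le_succ hnm
    have hgsup : ∀ x, (⨆ n, g n x) = ENNReal.ofReal (gradSq v x) := by
      intro x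
      apply le_antisymm
      · exact iSup_le fun n => ENNReal.ofReal_le_ofReal
          (mul_le_of_le_one_right (gradSq_nonneg v x) (hat_le_one hθ1 _))
      · obtain ⟨N, hN⟩ := exists_nat_gt (2 * ‖x‖)
        refine le_iSup_of_le N (le_of_eq ?_)
        have hlt : ‖x‖ / (N + 1 : ℝ) < 1 / 2 := by
          rw [div_lt_iff₀ (by positivity)]; linarith [norm_nonneg x]
        rw [hg]
        dsimp only
        rw [hat_eq_one hlt, mul_one]
    have hgint : ∀ n, ∫⁻ x, g n x = ENNReal.ofReal (E (1 / 2) v (n + 1)) := by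
      intro n
      rw [hg]
      simp only
      rw [E, ← ofReal_integral_eq_lintegral_ofReal (integrable_gradSq_mul_hat hθ1 hv (by positivity))
        (ae_of_all _ fun x => mul_nonneg (gradSq_nonneg v x) (hat_nonneg hθ1 _))]
    have hlin : ∫⁻ x, ENNReal.ofReal (gradSq v x) = ⨆ n, ∫⁻ x, g n x := by
      rw [← lintegral_iSup hgmeas hgmono]
      exact lintegral_congr fun x => (hgsup x).symm
    have hfin : ∫⁻ x, ENNReal.ofReal (gradSq v x) ≤ ENNReal.ofReal L := by
      rw [hlin]
      exact iSup_le fun n => (hgint n).le.trans (ENNReal.ofReal_le_ofReal (hL _ (by positivity)))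
    refine ⟨(continuous_gradSq' hv).aestronglyMeasurable, ?_⟩
    rw [hasFiniteIntegral_iff_enorm]
    calc ∫⁻ x, ‖gradSq v x‖ₑ = ∫⁻ x, ENNReal.ofReal (gradSq v x) :=
          lintegral_congr fun x => Real.enorm_eq_ofReal (gradSq_nonneg v x)
      _ ≤ ENNReal.ofReal L := hfin
      _ < ⊤ := ENNReal.ofReal_lt_top
  · -- unbounded branch: E → ∞, then Prop 8.1 at p = 2 and the ODE comparison
    exfalso
    push Not at hbdd
    have hE : Tendsto (E (1 / 2) v) atTop atTop := by
      refine tendsto_atTop_atTop.mpr fun b => ?_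
      obtain ⟨ρ₀, hρ₀, hb⟩ := hbdd b
      exact ⟨ρ₀, fun a ha => hb.le.trans (hmono (mem_Ioi.mpr hρ₀) (mem_Ioi.mpr (hρ₀.trans_le ha)) ha)⟩
    obtain ⟨c, ρstar, hc, hρstar, hode⟩ :=
      hP81 ν hν (1 / 2) hθ0 hθ1 2 (by norm_num) (by norm_num) v p hsol hweak hE
    obtain ⟨ρ₁, hρ₁⟩ := (tendsto_atTop_atTop.mp hE) 1
    refine ode_comparison_false (F := E (1 / 2) v) (ρ₀ := max ρstar ρ₁)
      (α := (12 - 5 * 2) / (3 * (3 - 2))) (β := (6 - 2) / (3 * (3 - 2))) hc (by norm_num) (by norm_num)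
      (hρstar.trans (le_max_left _ _)) (fun ρ h => hρ₁ ρ ((le_max_right _ _).trans h)) ?_
    intro ρ h
    exact hode ρ ((le_max_left _ _).trans h)

/-- The same link with the print's stated dependency on Lemma 2.2 carried as a binder
(`Step_L22 → Step_P81 → Step_T91`). [cite: Nahiru2026, Thm 9.1 p.14 l.5–91] -/
theorem step_T91_of_L22_P81 (_hL22 : Step_L22) (hP81 : Step_P81) : Step_T91 :=
  step_T91_of_P81 hP81

/-! ### The printed chain composed from its four remaining inputs -/

/-- **COMPOSITION THROUGH THE PROVED LINKS**: Prop 5.1 (11), Prop 7.2 (17), Lemma 2.2 and §10 —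
the print's remaining inputs — give Theorem 1.1 in kernel via §7.3, §8, §9 as printed.
[cite: Nahiru2026, §§7.3–9 p.12–14; §1.6 p.4 l.13–16] -/
theorem claim_of_P51_P72_L22_S10 (hP51 : Step_P51) (hP72 : Step_P72) (hL22 : Step_L22)
    (hS10 : Step_S10) : ClaimedTheorem :=
  claim_of_T91_S10 (step_T91_of_P81 (step_P81_of_T73_L22 (step_T73_of_P51_P72 hP51 hP72) hL22)) hS10

end Links

end Literature.Claims.NS.Nahiru2026

end
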